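import Literature.Computability.Cryptography.LiuPassSOWF
import Literature.Computability.Cryptography.LiuPassPadding
import Literature.Computability.Cryptography.YaoAmplification
import Literature.Computability.Complexity.StackUnaryBits
import HarnessLib

/-!
# Liu–Pass Thm 5.5 from Lemma 5.3: cond EP-PRGs from regular `S`-one-way functions

The tree's named fact `condEPPRG_of_OWFExist` (`LiuPassPadding.lean`; Y. Liu, R. Pass, FOCS 2020,
Thm 5.5: OWFs ⇒ for all `γ, δ > 1` a `1/n^δ`-cond EP-PRG of stretch `γ⌊log₂ n⌋`) is the last leaf of
the forward direction of S02. This file proves it **from Lemma 5.3 as a named fact**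
(`liuPass_lemma53`: a regular `S`-OWF gives the hashed family `f'_i` and Goldreich–Levin bits with
the printed density and pseudorandomness — the HILL/GL content, proved in the paper's appendix from
the Leftover Hash Lemma and the Goldreich–Levin theorem) and two TM2 efficiency facts
(`condGen_polyTime`, `condRedRun_polyTime`, to be discharged with `PlumbingBricks.lean`):

* `condEPPRG_of_OWFExist_of_lemma53 : liuPass_lemma53 → condGen_polyTime → condRedRun_polyTime →
  condEPPRG_of_OWFExist`.

Everything else in the printed proof of Thm 5.5 is proved here:

* **Lemma 2.2** (`le_mapEntropy_of_sdUnif_le`): `SD(X, U_n) ≤ 1/n²` ⇒ `H(X) ≥ n - 2`, for `X = F(U_S)`,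
  with the bridge `tvDist_condUniform_map_eq_sdUnif` from Mathlib's `PMF`s to the finite sum;
* **Lemma 5.4** is `LiuPassRegular.lean`/`LiuPassSOWF.lean` (`isSOWF_lpRegSet`, `card_lpRegSet`,
  `preimCard_of_mem_lpRegSet`);
* the construction (`CondParams.G`, `CondParams.E`): seeds of a designed length
  `seedLen n = (⌊log₂ n⌋+1) + n + 3n^c` carry the index `i` in binary (`natBits` of `StackUnaryBits.lean`, least significant bit first), then Lemma 5.3's
  seed `x ‖ σ`; `G` applies `f'_i ‖ GL` to the longest designed prefix (`nOfS`), passes the remaining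
  seed bits through (`padGen` of `LiuPassPadding.lean`) and cuts to the exact stretch `lpInner γ`;
  the events fix `i = r(n)` and `x ∈ S_n` (`CondParams.core`, `padSeeds`);
* **entropy** (`CondParams.entropy_G`): `H ≥ N - (γ'+2)log₂ N` from Lemma 2.2, `H(F ‖ GL) ≥ H(F)`
  (`mapEntropy_comp_le`), reindexing by the constant index field (`mapEntropy_image`), the
  pass-through bits (`mapEntropy_padSeeds`) and the truncation loss (`mapEntropy_take_ge`);
* **pseudorandomness** (`CondParams.pseudorandom_G`): a PPT `D'` against `G(U_N | E_N)` with advantage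
  `≥ 1/N^δ` infinitely often yields the distinguisher `CondParams.red` against Lemma 5.3's ensembles
  at the block length `n` with the *same* advantage (`acceptPMF_red_cond`, `acceptPMF_red_uniform`),
  contradicting `4/n^{α'/2} < 1/N^δ` (`security_margin`). As in `LiuPassPadding.lean` and
  `YaoAmplification.lean`, the target length `N` and `D'`'s coin count are carried by the *number
  of coins* of the reduction (`Code`, decoded by `mod`/`div`, `redRun_eq`), on a sparse set of block
  lengths selected with `Yao.seqN`/`Yao.sel` so that the input length determines the block length;
* the arithmetic of the parameters (`α' = 2(2c + cδ + 1)`, `γ' = 2α' + 8(c+1)(γ+1)`; print takes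
  `α' = 8cδ`, `γ' = (c+1)γ + 2α' + 3`): `log_N_le`, `ℓ_eq`, `lpInner_le_outLen` (the stretch),
  `density_margin`, `security_margin`.

Deviations from print, all forced by exact output lengths in `IsCondEPPRG` and by the tree's model
of probabilistic machines: the output is cut to exactly `N + γ⌊log₂ N⌋` (print: "at least `γ log n'`
bits"), both parts of `f'_i ‖ GL` are forced to their nominal lengths (`fitLen`; identity on the
event), and Lemma 5.3 is used in the special case `s(n) = n - ⌊log₂ n⌋ - 1` (print: `n - log n`).

## References

* Y. Liu, R. Pass, *On one-way functions and Kolmogorov complexity*, FOCS 2020 (arXiv:2009.11514),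
  §2.6 (Lemma 2.2), §5.3 (Lemmas 5.3, 5.4, Thm 5.5 and its proof), Appendix (proof of Lemma 5.3).
* O. Goldreich, *Foundations of Cryptography I*, CUP 2001, §3.5 (PRGs from regular OWFs).
* T. M. Cover, J. A. Thomas, *Elements of Information Theory*, 2nd ed., Wiley 2006, Ch. 2.
-/

namespace Literature.Computability.Cryptography

open Filter Finset _root_.Computability Complexity

/-! ### Lemma 2.2: statistical closeness to uniform forces high Shannon entropy -/

section SDEntropy

variable {ι : Type*}

/-- The probability of the value `v` under `F(U_S)`: `|F⁻¹(v) ∩ S| / |S|`. [folklore] -/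
noncomputable def imgProb (S : Finset ι) (F : ι → List Bool) (v : List Bool) : ℝ :=
  (fiber S F v).card / S.card

/-- The probability of `v` under `U_n`. [folklore] -/
noncomputable def unifProb (n : ℕ) (v : List Bool) : ℝ := if v.length = n then ((2 : ℝ) ^ n)⁻¹ else 0

/-- The (finite) support of `F(U_S)` and `U_n` together. [folklore] -/
noncomputable def sdSupport (S : Finset ι) (F : ι → List Bool) (n : ℕ) : Finset (List Bool) :=
  S.image F ∪ Finset.univ.image (List.Vector.toList : List.Vector Bool n → List Bool)

/-- **Statistical distance of `F(U_S)` to `U_n`** as a finite sum: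
`SD = ½ Σ_v |Pr[F(U_S) = v] - Pr[U_n = v]|`. [Y. Liu, R. Pass, FOCS 2020, §2.6] [cite: LiuPassFOCS2020, §2.6] -/
noncomputable def sdUnif (S : Finset ι) (F : ι → List Bool) (n : ℕ) : ℝ :=
  2⁻¹ * ∑ v ∈ sdSupport S F n, |imgProb S F v - unifProb n v|

/-- `imgProb ≥ 0`. [folklore] -/
theorem imgProb_nonneg (S : Finset ι) (F : ι → List Bool) (v : List Bool) : 0 ≤ imgProb S F v := by
  unfold imgProb; positivity

/-- `unifProb n v ≤ 2⁻ⁿ`. [folklore] -/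
theorem unifProb_le (n : ℕ) (v : List Bool) : unifProb n v ≤ ((2 : ℝ) ^ n)⁻¹ := by
  unfold unifProb; split_ifs
  · exact le_rfl
  · positivity

/-- The mass of the values of probability `> 2^{-(n-1)}` is at most `4 · SD`.
[Y. Liu, R. Pass, FOCS 2020, proof of Lemma 2.2] [cite: LiuPassFOCS2020, Lemma 2.2 (proof)] -/
theorem sum_imgProb_filter_le (S : Finset ι) (F : ι → List Bool) (n : ℕ) :
    ∑ v ∈ (S.image F).filter (fun v => 2 * ((2 : ℝ) ^ n)⁻¹ < imgProb S F v), imgProb S F v ≤ 4 * sdUnif S F n := by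
  classical
  have hpt : ∀ v ∈ (S.image F).filter (fun v => 2 * ((2 : ℝ) ^ n)⁻¹ < imgProb S F v),
      imgProb S F v ≤ 2 * |imgProb S F v - unifProb n v| := by
    intro v hv
    rw [Finset.mem_filter] at hv
    have hu := unifProb_le n v
    have ha : (0 : ℝ) ≤ ((2 : ℝ) ^ n)⁻¹ := by positivity
    rw [abs_of_nonneg (by linarith)]
    linarith
  calc ∑ v ∈ (S.image F).filter (fun v => 2 * ((2 : ℝ) ^ n)⁻¹ < imgProb S F v), imgProb S F v
      ≤ ∑ v ∈ (S.image F).filter (fun v => 2 * ((2 : ℝ) ^ n)⁻¹ < imgProb S F v), 2 * |imgProb S F v - unifProb n v| :=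
        Finset.sum_le_sum hpt
    _ ≤ ∑ v ∈ sdSupport S F n, 2 * |imgProb S F v - unifProb n v| := by
        refine Finset.sum_le_sum_of_subset_of_nonneg ?_ fun v _ _ => by positivity
        exact (Finset.filter_subset _ _).trans Finset.subset_union_left
    _ = 4 * sdUnif S F n := by rw [sdUnif, ← Finset.mul_sum]; ring

/-- **Liu–Pass Lemma 2.2** ("any distribution that is statistically close to random has very high
Shannon entropy"): for `n ≥ 4`, if `SD(F(U_S), U_n) ≤ 1/n²` then `H(F(U_S)) ≥ n - 2`.
Proof as printed: the values of probability `≤ 2^{-(n-1)}` have surprise `≥ n - 1` and carry mass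
`≥ 1 - 4/n²`. [Y. Liu, R. Pass, FOCS 2020, Lemma 2.2; arXiv:2009.11514, §2.6]
[cite: LiuPassFOCS2020, Lemma 2.2] -/
theorem le_mapEntropy_of_sdUnif_le {S : Finset ι} (hS : S.Nonempty) (F : ι → List Bool) {n : ℕ} (hn : 4 ≤ n)
    (hsd : sdUnif S F n ≤ 1 / (n : ℝ) ^ 2) : (n : ℝ) - 2 ≤ mapEntropy S F := by
  classical
  have hSpos : (0 : ℝ) < S.card := by exact_mod_cast hS.card_pos
  have hn0 : (0 : ℝ) < n := by exact_mod_cast (show 0 < n by omega)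
  set θ : ℝ := 2 * ((2 : ℝ) ^ n)⁻¹ with hθ
  set Bad := S.filter (fun w => θ < imgProb S F (F w)) with hBad
  set Good := S.filter (fun w => ¬ θ < imgProb S F (F w)) with hGood
  -- mass of Bad
  have hmass : (Bad.card : ℝ) / S.card = ∑ v ∈ (S.image F).filter (fun v => θ < imgProb S F v), imgProb S F v := by
    rw [Finset.card_eq_sum_card_fiberwise (f := F) (s := Bad) (t := (S.image F).filter (fun v => θ < imgProb S F v))
      (fun w hw => by
        have hw' : w ∈ Bad := hw
        rw [hBad, Finset.mem_filter] at hw'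
        exact Finset.mem_filter.2 ⟨Finset.mem_image_of_mem F hw'.1, hw'.2⟩)]
    push_cast
    rw [Finset.sum_div]
    refine Finset.sum_congr rfl fun v hv => ?_
    rw [Finset.mem_filter] at hv
    have hfib : Bad.filter (fun w => F w = v) = fiber S F v := by
      ext w
      simp only [hBad, Finset.mem_filter, mem_fiber]
      constructor
      · rintro ⟨⟨hw, _⟩, hwv⟩; exact ⟨hw, hwv⟩
      · rintro ⟨hw, hwv⟩; exact ⟨⟨hw, by rw [hwv]; exact hv.2⟩, hwv⟩
    rw [hfib, imgProb]
  have hBadle : (Bad.card : ℝ) / S.card ≤ 4 / (n : ℝ) ^ 2 := by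
    rw [hmass]
    calc _ ≤ 4 * sdUnif S F n := sum_imgProb_filter_le S F n
      _ ≤ 4 * (1 / (n : ℝ) ^ 2) := by gcongr
      _ = 4 / (n : ℝ) ^ 2 := by ring
  -- surprise on Good
  have hsur : ∀ w ∈ Good, (n : ℝ) - 1 ≤ Real.logb 2 ((S.card : ℝ) / (fiber S F (F w)).card) := by
    intro w hw
    rw [hGood, Finset.mem_filter, not_lt] at hw
    have hfpos : (0 : ℝ) < (fiber S F (F w)).card := by exact_mod_cast card_fiber_pos F hw.1
    have hp : imgProb S F (F w) ≤ θ := hw.2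
    unfold imgProb at hp
    have hratio : (2 : ℝ) ^ (n - 1) ≤ (S.card : ℝ) / (fiber S F (F w)).card := by
      rw [le_div_iff₀ hfpos]
      rw [div_le_iff₀ hSpos, hθ] at hp
      have h2 : (2 : ℝ) ^ n = 2 * 2 ^ (n - 1) := by
        rw [← pow_succ']; congr 1; omega
      rw [h2] at hp
      have h3 : (2 : ℝ) * (2 * 2 ^ (n - 1))⁻¹ * S.card = S.card / 2 ^ (n - 1) := by
        field_simp
      rw [h3, le_div_iff₀ (by positivity)] at hp
      linarith
    calc (n : ℝ) - 1 = Real.logb 2 ((2 : ℝ) ^ (n - 1)) := by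
          rw [Real.logb_pow, Real.logb_self_eq_one (by norm_num)]
          push_cast [Nat.cast_sub (show 1 ≤ n by omega)]
          ring
      _ ≤ _ := Real.logb_le_logb_of_le (by norm_num) (by positivity) hratio
  -- assemble
  have hcardGB : (Good.card : ℝ) + Bad.card = S.card := by
    have := Finset.card_filter_add_card_filter_not (s := S) (fun w => θ < imgProb S F (F w))
    rw [← hBad, ← hGood] at this
    push_cast [← this]
    ring
  unfold mapEntropy
  rw [le_div_iff₀ hSpos]
  have hsplit : ∑ w ∈ S, Real.logb 2 ((S.card : ℝ) / (fiber S F (F w)).card) =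
      ∑ w ∈ Good, Real.logb 2 ((S.card : ℝ) / (fiber S F (F w)).card) +
        ∑ w ∈ Bad, Real.logb 2 ((S.card : ℝ) / (fiber S F (F w)).card) := by
    rw [hGood, hBad, add_comm, Finset.sum_filter_add_sum_filter_not]
  have hGoodsum : (Good.card : ℝ) * ((n : ℝ) - 1) ≤ ∑ w ∈ Good, Real.logb 2 ((S.card : ℝ) / (fiber S F (F w)).card) := by
    have h := Finset.card_nsmul_le_sum Good (fun w => Real.logb 2 ((S.card : ℝ) / (fiber S F (F w)).card)) ((n : ℝ) - 1) hsur
    rwa [nsmul_eq_mul] at h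
  have hBadsum : 0 ≤ ∑ w ∈ Bad, Real.logb 2 ((S.card : ℝ) / (fiber S F (F w)).card) :=
    Finset.sum_nonneg fun w hw => logb_card_div_card_fiber_nonneg F (Finset.mem_filter.1 hw).1
  have hG : (Good.card : ℝ) = S.card - Bad.card := by linarith
  have hB : (Bad.card : ℝ) ≤ 4 / (n : ℝ) ^ 2 * S.card := by rwa [div_le_iff₀ hSpos] at hBadle
  have hn4 : (4 : ℝ) ≤ n := by exact_mod_cast hn
  have hkey : ((n : ℝ) - 2) * S.card ≤ (S.card - 4 / (n : ℝ) ^ 2 * S.card) * ((n : ℝ) - 1) := by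
    have h1 : ((n : ℝ) - 2) ≤ (1 - 4 / (n : ℝ) ^ 2) * ((n : ℝ) - 1) := by
      rw [sub_mul, one_mul, div_mul_eq_mul_div, sub_le_sub_iff]
      have : 4 * ((n : ℝ) - 1) / (n : ℝ) ^ 2 ≤ 1 := by
        rw [div_le_one (by positivity)]; nlinarith
      linarith
    have := mul_le_mul_of_nonneg_right h1 hSpos.le
    linarith [this]
  calc ((n : ℝ) - 2) * S.card ≤ (S.card - 4 / (n : ℝ) ^ 2 * S.card) * ((n : ℝ) - 1) := hkey
    _ ≤ (Good.card : ℝ) * ((n : ℝ) - 1) := by rw [hG]; exact mul_le_mul_of_nonneg_right (by linarith) (by linarith)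
    _ ≤ _ := by rw [hsplit]; linarith

end SDEntropy

/-! ### Statistical distance of finite distributions: `PMF.tvDist` as the finite sum -/

section Bridge

open scoped ENNReal

/-- The image distribution of `condUniform S` under `F` gives mass `imgProb S F v` to `v`. [folklore] -/
theorem toReal_condUniform_map_apply {S : Finset (List Bool)} (hS : S.Nonempty) (F : List Bool → List Bool) (v : List Bool) :
    (((condUniform S).map F) v).toReal = imgProb S F v := by
  classical
  rw [condUniform_eq hS, ← PMF.toOuterMeasure_apply_singleton, PMF.toOuterMeasure_map_apply,
    PMF.toOuterMeasure_uniformOfFinset_apply, ENNReal.toReal_div, ENNReal.toReal_natCast, ENNReal.toReal_natCast, imgProb]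
  congr 2
  unfold fiber
  congr 1
  ext w
  simp

/-- `U_n` gives mass `unifProb n v` to `v`. [Goldreich 2001, §1.3] [folklore] -/
theorem toReal_uniformBits_apply (n : ℕ) (v : List Bool) : (uniformBits n v).toReal = unifProb n v := by
  classical
  unfold uniformBits
  rw [← PMF.toOuterMeasure_apply_singleton, PMF.toOuterMeasure_map_apply, PMF.toOuterMeasure_uniformOfFintype_apply,
    card_vector, Fintype.card_bool, ENNReal.toReal_div]
  have hcard : Fintype.card ↥(List.Vector.toList ⁻¹' ({v} : Set (List Bool)) : Set (List.Vector Bool n)) =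
      if v.length = n then 1 else 0 := by
    rw [Fintype.card_subtype]
    split_ifs with h
    · rw [Finset.card_eq_one]
      refine ⟨⟨v, h⟩, ?_⟩
      ext w
      simp only [Finset.mem_filter, Finset.mem_univ, true_and, Set.mem_preimage, Set.mem_singleton_iff, Finset.mem_singleton]
      constructor
      · intro hw; exact Subtype.ext hw
      · intro hw; rw [hw]; rfl
    · rw [Finset.card_eq_zero, Finset.filter_eq_empty_iff]
      intro w _ hw
      simp only [Set.mem_preimage, Set.mem_singleton_iff] at hw
      exact h (by rw [← hw]; exact w.toList_length)
  rw [hcard, unifProb]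
  split_ifs <;> simp

/-- **`PMF.tvDist` of `F(U_S)` and `U_n` is the finite sum `sdUnif S F n`.** [folklore] -/
theorem tvDist_condUniform_map_eq_sdUnif {S : Finset (List Bool)} (hS : S.Nonempty) (F : List Bool → List Bool) (n : ℕ) :
    ((condUniform S).map F).tvDist (uniformBits n) = sdUnif S F n := by
  classical
  unfold PMF.tvDist sdUnif
  congr 1
  rw [tsum_eq_sum (s := sdSupport S F n)]
  · exact Finset.sum_congr rfl fun v _ => by rw [toReal_condUniform_map_apply hS, toReal_uniformBits_apply]
  · intro v hv
    rw [toReal_condUniform_map_apply hS, toReal_uniformBits_apply]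
    simp only [sdSupport, Finset.mem_union, Finset.mem_image, Finset.mem_univ, true_and, not_or, not_exists, not_and] at hv
    have h1 : imgProb S F v = 0 := by
      unfold imgProb fiber
      rw [Finset.card_eq_zero.2, Nat.cast_zero, zero_div]
      rw [Finset.filter_eq_empty_iff]
      exact fun w hw hwv => hv.1 w hw hwv
    have h2 : unifProb n v = 0 := by
      unfold unifProb
      rw [if_neg]
      intro hlen
      exact hv.2 ⟨v, hlen⟩ rfl
    rw [h1, h2]; simp

end Bridge

/-! ### Lemma 5.3 as a named fact -/

section Lemma53

/-- `f` is **regular over `S` with regularity `r`**: every `x ∈ S_n` has between `2^{r(n)-1}` and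
`2^{r(n)}` preimages of length `n`. [Y. Liu, R. Pass, FOCS 2020, §5.3 (Def. of an `r`-regular
`S`-OWF)] [cite: LiuPassFOCS2020, Lemma 5.3] -/
def IsRegularOver (f : List Bool → List Bool) (S : ∀ n : ℕ, Finset (List.Vector Bool n)) (r : ℕ → ℕ) : Prop :=
  ∀ (n : ℕ) (x : List.Vector Bool n), x ∈ S n → 2 ^ (r n - 1) ≤ preimCard f n x.toList ∧ preimCard f n x.toList ≤ 2 ^ r n

/-- The seeds of Lemma 5.3 at block length `n`: `x ‖ σ` with `x ∈ S_n` and `σ = σ₁ ‖ σ₂ ‖ σ_GL`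
uniform of length `3n^c`. [Y. Liu, R. Pass, FOCS 2020, Lemma 5.3] [cite: LiuPassFOCS2020, Lemma 5.3] -/
def lpSeeds (S : ∀ n : ℕ, Finset (List.Vector Bool n)) (c n : ℕ) : Finset (List Bool) :=
  (S n ×ˢ (Finset.univ : Finset (List.Vector Bool (3 * n ^ c)))).image fun q => q.1.toList ++ q.2.toList

/-- The entropy parameter `s(n) = n - ⌊log₂ n⌋ - 1` (print, proof of Thm 5.5: "let `s(n) = n - log n`
(to ensure that `s(n) ≤ log |S_n|`)"; the extra `-1` absorbs the floor for `|S_n| ≥ 2ⁿ/n`). [Y. Liu,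
R. Pass, FOCS 2020, proof of Thm 5.5] [cite: LiuPassFOCS2020, Thm 5.5 (proof)] -/
def lpS53 (n : ℕ) : ℕ := n - Nat.log 2 n - 1

/-- The output length `ℓ(n) = s(n) + 3n^c - 2α' ⌊log₂ n⌋` of `f'_{r(n)}`. [Y. Liu, R. Pass, FOCS 2020,
Lemma 5.3] [cite: LiuPassFOCS2020, Lemma 5.3] -/
def lpLen53 (c α' n : ℕ) : ℕ := lpS53 n + 3 * n ^ c - 2 * α' * Nat.log 2 n

/-- **Liu–Pass 2020, Lemma 5.3** ("implicit in [Gol01, Yu]"; self-contained proof in the appendix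
of arXiv:2009.11514), named fact (D-0014), **in the special case `s(n) = n - ⌊log₂ n⌋ - 1` of the
proof of Thm 5.5** (print allows any efficiently computable `s(n) ≤ log |S_n|`). Print: "Let
`S = {S_n}`, `S_n ⊆ {0,1}ⁿ`, `s` efficiently computable with `s(n) ≤ log |S_n|`, and `f` an `S`-OWF
with regularity `r(·)`. Then there exists a constant `c ≥ 1` such that for every `α', γ' ≥ 0`
there exist an efficiently computable family `{f'_i}` and an efficiently computable `GL` such
that, for `ℓ(n) = s(n) + 3n^c - 2α' log n`, `ℓ'(n) = ℓ(n) + γ' log n`: (density) for all large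
`n`, `{x ← S_n, σ₁,σ₂,σ_GL ← {0,1}^{n^c} : f'_{r(n)}(x,σ₁,σ₂,σ_GL)}` is `3/n^{α'/2}`-close to
`U_{ℓ(n)}`; (pseudorandomness) `{f'_{r(n)}(…) ‖ GL(…)}` and `{U_{ℓ'(n)}}` are
`4/n^{α'/2}`-indistinguishable." Rendering: `|S_n| ≥ 2ⁿ/n` as the hypothesis making `s(n) ≤ log |S_n|`;
the family as one polynomial-time function of `⟨1ⁱ, x ‖ σ⟩` (index in unary); seeds `lpSeeds`;
statistical distance `PMF.tvDist` to `uniformBits`; indistinguishability as in `IsCondEPPRG`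
(`distAdvantage` of PPT distinguishers at security parameter `n`, eventually `≤ 4/n^{α'/2}`). Not
proved here: the printed proof combines the Leftover Hash Lemma [HILL99] (twice, hashing input and
output with a Carter–Wegman family), the Goldreich–Levin theorem with `O(log n)` output bits for
*hiding* functions [GL89; HHR06, Thm 2.12], and the claim that the hashed `f` is `S`-hiding.
[Y. Liu, R. Pass, FOCS 2020, Lemma 5.3 and Appendix (proof); arXiv:2009.11514v1, §5.3]
[cite: LiuPassFOCS2020, Lemma 5.3] -/
def liuPass_lemma53 : Prop :=
  ∀ (f : List Bool → List Bool) (S : ∀ n : ℕ, Finset (List.Vector Bool n)) (r : ℕ → ℕ),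
    IsSOWF f S → IsRegularOver f S r → (∀ n, 1 ≤ n → 2 ^ n ≤ n * (S n).card) →
    ∃ c : ℕ, 1 ≤ c ∧ ∀ α' γ' : ℕ, ∃ (F : ℕ → List Bool → List Bool) (Hc : List Bool → List Bool),
      PolyTimeComputable id id (fun z => F (boolUnpair z).1.length (boolUnpair z).2) ∧
      PolyTimeComputable id id Hc ∧
      (∀ᶠ n in atTop, ∀ w ∈ lpSeeds S c n, (F (r n) w).length = lpLen53 c α' n ∧ (Hc w).length = γ' * Nat.log 2 n) ∧
      (∀ᶠ n in atTop, ((condUniform (lpSeeds S c n)).map (F (r n))).tvDist (uniformBits (lpLen53 c α' n))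
          ≤ 3 / (n : ℝ) ^ ((α' : ℝ) / 2)) ∧
      (∀ D : RandAlg (List Bool) Bool, IsPPT D encodeBool → ∀ᶠ n in atTop,
        distAdvantage D (fun n => (condUniform (lpSeeds S c n)).map fun w => F (r n) w ++ Hc w)
          (uniformEnsemble fun n => lpLen53 c α' n + γ' * Nat.log 2 n) n ≤ 4 / (n : ℝ) ^ ((α' : ℝ) / 2))

end Lemma53

/-! ### The construction of Thm 5.5: designed lengths, parsing, the generator and its events -/

section Construction

/-- The parameters of Thm 5.5's construction: the block data of Lemma 5.3 and the targets `γ, δ`.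
[Y. Liu, R. Pass, FOCS 2020, proof of Thm 5.5] [folklore] -/
structure CondParams where
  /-- the constant `c` of Lemma 5.3 (`σ`-lengths `n^c`) [folklore] -/
  c : ℕ
  /-- the stretch target `γ` [folklore] -/
  γ : ℕ
  /-- the security target `δ` [folklore] -/
  δ : ℕ
  /-- the regularity index `r(n)` [folklore] -/
  r : ℕ → ℕ
  /-- the family `f'_i` of Lemma 5.3 [folklore] -/
  F : ℕ → List Bool → List Bool
  /-- the hard-core function of Lemma 5.3 [folklore] -/
  Hc : List Bool → List Bool

namespace CondParams

variable (Q : CondParams)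

/-- `α' = 2(2c + cδ + 1)` (print: `α' = 8cδ`; any `α'` with `α'/2 > max(2c, cδ)` works). [folklore] -/
def α' : ℕ := 2 * (2 * Q.c + Q.c * Q.δ + 1)
/-- `α'/2`. [folklore] -/
def e : ℕ := 2 * Q.c + Q.c * Q.δ + 1
/-- `γ' = 2α' + 8(c+1)(γ+1)` (print: `(c+1)γ + 2α' + 3`, up to floors). [folklore] -/
def γ' : ℕ := 2 * Q.α' + 8 * (Q.c + 1) * (Q.γ + 1)
/-- Width of the index field: `⌊log₂ n⌋ + 1` bits (enough for `i ≤ n`). [folklore] -/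
def b (n : ℕ) : ℕ := Nat.log 2 n + 1
/-- Length of the Lemma-5.3 part of the seed: `n + 3n^c`. [folklore] -/
def m (n : ℕ) : ℕ := n + 3 * n ^ Q.c
/-- **Designed seed length** `n' = (⌊log₂ n⌋ + 1) + n + 3n^c`. [Y. Liu, R. Pass, FOCS 2020, proof of Thm 5.5] [folklore] -/
def seedLen (n : ℕ) : ℕ := b n + Q.m n
/-- `ℓ(n)`. [folklore] -/
def ℓ (n : ℕ) : ℕ := lpLen53 Q.c Q.α' n
/-- `ℓ'(n) = ℓ(n) + γ' ⌊log₂ n⌋`. [folklore] -/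
def ℓ' (n : ℕ) : ℕ := Q.ℓ n + Q.γ' * Nat.log 2 n
/-- The block length used at seed length `N`: the largest `n` with `seedLen n ≤ N`. [Y. Liu, R. Pass,
FOCS 2020, proof of Thm 5.5 ("a prefix `x` of `x'` as long as possible such that `|x|` is of the
form `n'`")] [folklore] -/
def nOfS (N : ℕ) : ℕ := Nat.findGreatest (fun n => Q.seedLen n ≤ N) N
/-- The pass-through part `N - seedLen n`. [folklore] -/
def extra (N : ℕ) : ℕ := N - Q.seedLen (Q.nOfS N)
/-- Output length before truncation. [folklore] -/
def outLen (N : ℕ) : ℕ := Q.ℓ' (Q.nOfS N) + Q.extra N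

/-- Force a string to length `L` (truncate or pad with `0`s). [folklore] -/
def fitLen (v : List Bool) (L : ℕ) : List Bool := (v ++ List.replicate L false).take L

/-- `|fitLen v L| = L`. [folklore] -/
@[simp] theorem length_fitLen (v : List Bool) (L : ℕ) : (fitLen v L).length = L := by
  simp [fitLen]

/-- `fitLen` is the identity on strings of the right length. [folklore] -/
theorem fitLen_of_length_eq {v : List Bool} {L : ℕ} (h : v.length = L) : fitLen v L = v := by
  simp [fitLen, ← h, List.take_left']

/-- The core generator on the designed part `v` (`|v| = seedLen n`): index field, then the
Lemma-5.3 seed `w`; output `f'_i(w) ‖ GL(w)` with both parts forced to their nominal lengths.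
[Y. Liu, R. Pass, FOCS 2020, proof of Thm 5.5 (`G_{δ,γ}(i,x,σ₁,σ₂,σ_GL) = f'_i(…) ‖ GL(…)`)] [folklore] -/
def Gcore (n : ℕ) (v : List Bool) : List Bool :=
  fitLen (Q.F (bitsToNat (v.take (b n))) (v.drop (b n))) (Q.ℓ n) ++ fitLen (Q.Hc (v.drop (b n))) (Q.γ' * Nat.log 2 n)

/-- **The generator of Thm 5.5** on all seed lengths: with `n = nOfS |u|`, apply `Gcore n` to the
designed prefix, pass the remaining seed bits through, and cut to the exact stretch
`|u| + γ ⌊log₂ |u|⌋`. [Y. Liu, R. Pass, FOCS 2020, proof of Thm 5.5 (`G'_{δ,γ}(x ‖ y) = G_{δ,γ}(x) ‖ y`)]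
[folklore] -/
def G (u : List Bool) : List Bool :=
  (padGen (Q.Gcore (Q.nOfS u.length)) (Q.seedLen (Q.nOfS u.length)) u).take (lpInner Q.γ u.length)

variable (S : ∀ n : ℕ, Finset (List.Vector Bool n))

/-- The designed seeds at block length `n`: `natBits (r n) ‖ w`, `w ∈ lpSeeds`. [folklore] -/
def core (n : ℕ) : Finset (List Bool) := (lpSeeds S Q.c n).image fun w => Complexity.natBits (b n) (Q.r n) ++ w

/-- **The events of Thm 5.5**: `E_N = {CplxCore.natBits (r n) ‖ w ‖ y : w ∈ lpSeeds_n, |y| = N - seedLen n}`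
(`n = nOfS N`), or a dummy singleton when `S_n = ∅`. [Y. Liu, R. Pass, FOCS 2020, proof of Thm 5.5
(`E_{n'} = {i = r(n), x ∈ S_n, σ's}`)] [folklore] -/
noncomputable def E (N : ℕ) : Finset (List Bool) :=
  if (S (Q.nOfS N)).Nonempty ∧ Q.seedLen (Q.nOfS N) ≤ N then padSeeds (Q.core S (Q.nOfS N)) (Q.extra N)
  else {List.replicate N false}

/-! #### Elementary properties -/

/-- `seedLen` is strictly increasing. [folklore] -/
theorem seedLen_strictMono : StrictMono Q.seedLen := by
  refine strictMono_nat_of_lt_succ fun n => ?_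
  unfold seedLen m b
  have h1 : Nat.log 2 n ≤ Nat.log 2 (n + 1) := Nat.log_mono_right (Nat.le_succ n)
  have h2 : n ^ Q.c ≤ (n + 1) ^ Q.c := Nat.pow_le_pow_left (Nat.le_succ n) _
  omega

/-- `n ≤ seedLen n`. [folklore] -/
theorem le_seedLen (n : ℕ) : n ≤ Q.seedLen n := by unfold seedLen m; omega

/-- `seedLen (nOfS N) ≤ N` for `N ≥ 1`. [folklore] -/
theorem seedLen_nOfS_le (hc : 1 ≤ Q.c) {N : ℕ} (hN : 1 ≤ N) : Q.seedLen (Q.nOfS N) ≤ N := by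
  have h0 : Q.seedLen 0 ≤ N := by
    unfold seedLen m b
    rw [Nat.zero_pow (by omega : 0 < Q.c)]
    simp; omega
  exact Nat.findGreatest_spec (P := fun n => Q.seedLen n ≤ N) (Nat.zero_le N) h0

/-- `N < seedLen (nOfS N + 1)`. [folklore] -/
theorem lt_seedLen_succ (N : ℕ) : N < Q.seedLen (Q.nOfS N + 1) := by
  by_contra h
  push Not at h
  have hle : Q.nOfS N + 1 ≤ N := (Q.le_seedLen _).trans h
  have := Nat.le_findGreatest (P := fun n => Q.seedLen n ≤ N) hle h
  unfold nOfS at this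
  omega

/-- `nOfS` inverts `seedLen` on the designed ranges. [folklore] -/
theorem nOfS_eq (hc : 1 ≤ Q.c) {n N : ℕ} (h1 : Q.seedLen n ≤ N) (h2 : N < Q.seedLen (n + 1)) : Q.nOfS N = n := by
  have hmono := Q.seedLen_strictMono
  have hN : 1 ≤ N := by have := Q.le_seedLen n; unfold seedLen b at h1; omega
  have ha := Q.seedLen_nOfS_le hc hN
  have hb := Q.lt_seedLen_succ N
  have h3 : Q.nOfS N < n + 1 := hmono.lt_iff_lt.1 (ha.trans_lt h2)
  have h4 : n < Q.nOfS N + 1 := hmono.lt_iff_lt.1 (h1.trans_lt hb)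
  omega

/-- `nOfS N → ∞`. [folklore] -/
theorem tendsto_nOfS : Tendsto Q.nOfS atTop atTop := by
  refine tendsto_atTop_atTop.2 fun n => ⟨Q.seedLen n, fun N hN => ?_⟩
  by_contra h
  push Not at h
  have hb := Q.lt_seedLen_succ N
  have : Q.seedLen (Q.nOfS N + 1) ≤ Q.seedLen n := (Q.seedLen_strictMono).monotone (by omega)
  omega

/-- `nOfS N ≤ N`. [folklore] -/
theorem nOfS_le (N : ℕ) : Q.nOfS N ≤ N := Nat.findGreatest_le N

/-- Output length of the core generator. [folklore] -/
theorem length_Gcore (n : ℕ) (v : List Bool) : (Q.Gcore n v).length = Q.ℓ' n := by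
  simp [Gcore, ℓ']

/-- Members of `lpSeeds` have length `m n`. [folklore] -/
theorem length_of_mem_lpSeeds {c n : ℕ} {w : List Bool} (hw : w ∈ lpSeeds S c n) : w.length = n + 3 * n ^ c := by
  simp only [lpSeeds, Finset.mem_image, Finset.mem_product, Finset.mem_univ, and_true] at hw
  obtain ⟨q, _, rfl⟩ := hw
  simp

/-- Members of `core` have length `seedLen n`. [folklore] -/
theorem length_of_mem_core {n : ℕ} {v : List Bool} (hv : v ∈ Q.core S n) : v.length = Q.seedLen n := by
  simp only [core, Finset.mem_image] at hv
  obtain ⟨w, hw, rfl⟩ := hv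
  simp [length_of_mem_lpSeeds S hw, seedLen, m, b]

/-- `lpSeeds` is nonempty when `S_n` is. [folklore] -/
theorem lpSeeds_nonempty {c n : ℕ} (h : (S n).Nonempty) : (lpSeeds S c n).Nonempty := by
  obtain ⟨x, hx⟩ := h
  have hq : (x, (⟨List.replicate (3 * n ^ c) false, by simp⟩ : List.Vector Bool (3 * n ^ c))) ∈
      S n ×ˢ (Finset.univ : Finset (List.Vector Bool (3 * n ^ c))) := Finset.mk_mem_product hx (Finset.mem_univ _)
  exact ⟨_, Finset.mem_image_of_mem _ hq⟩

/-- `core` is nonempty when `S_n` is. [folklore] -/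
theorem core_nonempty {n : ℕ} (h : (S n).Nonempty) : (Q.core S n).Nonempty :=
  (lpSeeds_nonempty S h).image _

/-- **The events are nonempty and consist of seeds of length `N`.** [folklore] -/
theorem E_spec (N : ℕ) : (Q.E S N).Nonempty ∧ ∀ u ∈ Q.E S N, u.length = N := by
  unfold E
  split_ifs with h
  · refine ⟨padSeeds_nonempty (Q.core_nonempty S h.1) _, fun u hu => ?_⟩
    rw [length_of_mem_padSeeds (fun v hv => Q.length_of_mem_core S hv) hu, extra]
    have := h.2
    omega
  · exact ⟨⟨_, Finset.mem_singleton_self _⟩, fun u hu => by rw [Finset.mem_singleton.1 hu]; simp⟩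

/-- The core generator on a designed seed `natBits (r n) ‖ w`: `f'_{r(n)}(w) ‖ GL(w)` when the
lengths are nominal and `r n < 2^{b n}`. [folklore] -/
theorem Gcore_core {n : ℕ} (hr : Q.r n < 2 ^ b n) {w : List Bool} (hF : (Q.F (Q.r n) w).length = Q.ℓ n)
    (hH : (Q.Hc w).length = Q.γ' * Nat.log 2 n) :
    Q.Gcore n (Complexity.natBits (b n) (Q.r n) ++ w) = Q.F (Q.r n) w ++ Q.Hc w := by
  have hl : (Complexity.natBits (b n) (Q.r n)).length = b n := Complexity.length_natBits _ _
  simp only [Gcore, List.take_left' hl, List.drop_left' hl, Complexity.bitsToNat_natBits hr, fitLen_of_length_eq hF,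
    fitLen_of_length_eq hH]

end CondParams

end Construction

/-! ### Arithmetic of the parameters (logarithms, stretch, the two security margins) -/

section Arith

/-- `(j+1)² ≤ 2ʲ` for `j ≥ 6`. [folklore] -/
theorem succ_sq_le_two_pow : ∀ {j : ℕ}, 6 ≤ j → (j + 1) * (j + 1) ≤ 2 ^ j := by
  intro j hj
  induction j with
  | zero => omega
  | succ j ih =>
    rcases Nat.lt_or_ge j 6 with h | h
    · interval_cases j <;> simp_all
    · have := ih h
      have h2 : 2 * j + 3 ≤ 2 ^ j := by
        have : (6 + 1) * (6 + 1) ≤ 2 ^ 6 := by norm_num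
        calc 2 * j + 3 ≤ (j + 1) * (j + 1) := by nlinarith
          _ ≤ 2 ^ j := ih h
      rw [pow_succ]; nlinarith

/-- **`⌊log₂ n⌋` is eventually below any linear function**: `K ⌊log₂ n⌋ + K ≤ n` for `n ≥ 2^{K+6}`. [folklore] -/
theorem mul_log_add_le {K n : ℕ} (hn : 2 ^ (K + 6) ≤ n) : K * Nat.log 2 n + K ≤ n := by
  set j := Nat.log 2 n with hj
  have hn0 : n ≠ 0 := by have := Nat.one_le_two_pow (n := K + 6); omega
  have hjK : K + 6 ≤ j := by
    rw [hj]; exact Nat.le_log_of_pow_le (by norm_num) hn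
  have h1 : 2 ^ j ≤ n := Nat.pow_log_le_self 2 hn0
  have h2 := succ_sq_le_two_pow (j := j) (by omega)
  calc K * j + K = K * (j + 1) := by ring
    _ ≤ (j + 1) * (j + 1) := Nat.mul_le_mul_right _ (by omega)
    _ ≤ 2 ^ j := h2
    _ ≤ n := h1

/-- Eventual form. [folklore] -/
theorem eventually_mul_log_add_le (K : ℕ) : ∀ᶠ n in atTop, K * Nat.log 2 n + K ≤ n := by
  filter_upwards [eventually_ge_atTop (2 ^ (K + 6))] with n hn using mul_log_add_le hn

namespace CondParams

variable (Q : CondParams)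

/-- `seedLen (n+1) ≤ 5 (n+1)^c` (for `c ≥ 1`). [folklore] -/
theorem seedLen_succ_le (hc : 1 ≤ Q.c) (n : ℕ) : Q.seedLen (n + 1) ≤ 5 * (n + 1) ^ Q.c := by
  unfold seedLen m b
  have h1 : Nat.log 2 (n + 1) < n + 1 := Nat.log_lt_self 2 (by omega)
  have h2 : n + 1 ≤ (n + 1) ^ Q.c := by
    calc n + 1 = (n + 1) ^ 1 := (pow_one _).symm
      _ ≤ (n + 1) ^ Q.c := Nat.pow_le_pow_right (by omega) hc
  omega

/-- **`⌊log₂ N⌋ ≤ (c+1)(⌊log₂ n⌋ + 4)`** on the designed range of `n ≥ 1`. [folklore] -/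
theorem log_N_le (hc : 1 ≤ Q.c) {n N : ℕ} (hn : 1 ≤ n) (hN : N < Q.seedLen (n + 1)) :
    Nat.log 2 N ≤ (Q.c + 1) * (Nat.log 2 n + 4) := by
  have h1 := Q.seedLen_succ_le hc n
  have hn2 : n + 1 ≤ 2 * n := by omega
  have hlog : n < 2 ^ (Nat.log 2 n + 1) := Nat.lt_pow_succ_log_self (by norm_num) n
  have h2 : (n + 1) ^ Q.c ≤ 2 ^ (Q.c * (Nat.log 2 n + 2)) := by
    calc (n + 1) ^ Q.c ≤ (2 * n) ^ Q.c := Nat.pow_le_pow_left hn2 _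
      _ ≤ (2 * 2 ^ (Nat.log 2 n + 1)) ^ Q.c := Nat.pow_le_pow_left (by omega) _
      _ = 2 ^ (Q.c * (Nat.log 2 n + 2)) := by rw [← pow_succ', ← pow_mul]; ring_nf
  have h3 : N < 2 ^ (Q.c * (Nat.log 2 n + 2) + 3) := by
    calc N < 5 * (n + 1) ^ Q.c := by omega
      _ ≤ 8 * 2 ^ (Q.c * (Nat.log 2 n + 2)) := by omega
      _ = 2 ^ (Q.c * (Nat.log 2 n + 2) + 3) := by rw [pow_add]; norm_num; ring
  by_cases hN0 : N = 0
  · subst hN0; simp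
  · have := Nat.log_lt_of_lt_pow hN0 h3
    nlinarith

/-- `ℓ(n) ≤ 4 n^c` (for `c ≥ 1`). [folklore] -/
theorem ℓ_le (hc : 1 ≤ Q.c) (n : ℕ) : Q.ℓ n ≤ 4 * n ^ Q.c := by
  unfold ℓ lpLen53 lpS53
  have : n ≤ n ^ Q.c := by
    rcases Nat.eq_zero_or_pos n with rfl | hn
    · simp
    · calc n = n ^ 1 := (pow_one n).symm
        _ ≤ n ^ Q.c := Nat.pow_le_pow_right hn hc
  omega

/-- **No underflow in `ℓ(n)`** for large `n`:
`ℓ n + 2α'⌊log₂ n⌋ + ⌊log₂ n⌋ + 1 = n + 3n^c` (honest subtraction). [folklore] -/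
theorem ℓ_eq {n : ℕ} (hn : 2 ^ (2 * Q.α' + 1 + 6) ≤ n) :
    Q.ℓ n + 2 * Q.α' * Nat.log 2 n + Nat.log 2 n + 1 = n + 3 * n ^ Q.c := by
  have h := mul_log_add_le hn
  rw [Nat.add_mul, one_mul] at h
  unfold ℓ lpLen53 lpS53
  omega

/-- `ℓ n ≥ 3n^c ≥ 3` for large `n` (and `c ≥ 1`... only `n ≥ 1` is used). [folklore] -/
theorem three_le_ℓ {n : ℕ} (hn : 2 ^ (2 * Q.α' + 1 + 6) ≤ n) : 3 ≤ Q.ℓ n := by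
  have h := mul_log_add_le hn
  rw [Nat.add_mul, one_mul] at h
  have hℓ := Q.ℓ_eq hn
  have hn1 : 1 ≤ n := by have := Nat.one_le_two_pow (n := 2 * Q.α' + 1 + 6); omega
  have : 1 ≤ n ^ Q.c := Nat.one_le_pow _ _ hn1
  omega

/-- **The stretch**: on the designed range, `N + γ⌊log₂ N⌋ ≤ outLen N`, for large `n`. [folklore] -/
theorem lpInner_le_outLen (hc : 1 ≤ Q.c) {n N : ℕ} (hn : 2 ^ (2 * Q.α' + 1 + 6) ≤ n) (h1 : Q.seedLen n ≤ N)
    (h2 : N < Q.seedLen (n + 1)) : lpInner Q.γ N ≤ Q.outLen N := by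
  have hn1 : 1 ≤ n := by have := Nat.one_le_two_pow (n := 2 * Q.α' + 1 + 6); omega
  have hnOf : Q.nOfS N = n := Q.nOfS_eq hc h1 h2
  have hlogN := Q.log_N_le hc hn1 h2
  have hℓ := Q.ℓ_eq hn
  have hlog1 : 1 ≤ Nat.log 2 n := by
    refine Nat.le_log_of_pow_le (by norm_num) (le_trans ?_ hn)
    exact Nat.pow_le_pow_right (by norm_num) (by omega)
  unfold outLen extra ℓ' lpInner
  rw [hnOf]
  unfold seedLen m b at h1 ⊢
  set L := Nat.log 2 n with hL
  set LN := Nat.log 2 N with hLN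
  -- the key linear estimate
  have s1 : Q.γ * LN ≤ Q.γ * (Q.c + 1) * L + 4 * Q.γ * (Q.c + 1) := by
    have hA : Q.γ * LN ≤ Q.γ * ((Q.c + 1) * (L + 4)) := Nat.mul_le_mul_left _ hlogN
    have : Q.γ * ((Q.c + 1) * (L + 4)) = Q.γ * (Q.c + 1) * L + 4 * Q.γ * (Q.c + 1) := by ring
    omega
  have s2 : 4 * Q.γ * (Q.c + 1) + 2 ≤ (4 * Q.γ * (Q.c + 1) + 2) * L := Nat.le_mul_of_pos_right _ hlog1
  have s3 : (5 * (Q.γ * (Q.c + 1)) + 4) * L ≤ (8 * (Q.c + 1) * (Q.γ + 1)) * L := by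
    apply Nat.mul_le_mul_right
    nlinarith
  have key : Q.γ * LN + L + 1 + L + 1 ≤ (8 * (Q.c + 1) * (Q.γ + 1)) * L := by
    have e1 : (4 * Q.γ * (Q.c + 1) + 2) * L = 4 * (Q.γ * (Q.c + 1)) * L + 2 * L := by ring
    have e2 : (5 * (Q.γ * (Q.c + 1)) + 4) * L = Q.γ * (Q.c + 1) * L + 4 * (Q.γ * (Q.c + 1)) * L + 2 * L + 2 * L := by ring
    have e3 : Q.γ * (Q.c + 1) * L = Q.γ * (Q.c + 1) * L := rfl
    omega
  have hγ' : Q.γ' * L = 2 * Q.α' * L + (8 * (Q.c + 1) * (Q.γ + 1)) * L := by unfold γ'; ring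
  omega

/-- `(α'/2 : ℝ) = e`. [folklore] -/
theorem α'_div_two : ((Q.α' : ℝ) / 2) = (Q.e : ℝ) := by
  simp [α', e]

/-- `n^{α'/2} = n^e` as real powers. [folklore] -/
theorem rpow_α' (n : ℕ) : (n : ℝ) ^ ((Q.α' : ℝ) / 2) = (n : ℝ) ^ Q.e := by
  rw [α'_div_two, Real.rpow_natCast]

/-- **Entropy margin**: `3/n^{α'/2} ≤ 1/ℓ(n)²` for large `n`. [folklore] -/
theorem density_margin (hc : 1 ≤ Q.c) {n : ℕ} (hn : 2 ^ (2 * Q.α' + 1 + 6) ≤ n) :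
    3 / (n : ℝ) ^ ((Q.α' : ℝ) / 2) ≤ 1 / (Q.ℓ n : ℝ) ^ 2 := by
  rw [Q.rpow_α']
  have hn64 : 64 ≤ n := le_trans (Nat.pow_le_pow_right (by norm_num : 0 < 2) (by omega : 6 ≤ 2 * Q.α' + 1 + 6)) hn
  have hn0 : (0 : ℝ) < n := by exact_mod_cast (show 0 < n by omega)
  have hℓ := Q.ℓ_le hc n
  have hℓ3 := Q.three_le_ℓ hn
  have hℓr : (0 : ℝ) < Q.ℓ n := by exact_mod_cast (show 0 < Q.ℓ n by omega)
  rw [div_le_div_iff₀ (by positivity) (by positivity), one_mul]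
  have h1 : (Q.ℓ n : ℝ) ^ 2 ≤ 16 * (n : ℝ) ^ (2 * Q.c) := by
    have : (Q.ℓ n : ℝ) ≤ 4 * (n : ℝ) ^ Q.c := by exact_mod_cast hℓ
    calc (Q.ℓ n : ℝ) ^ 2 ≤ (4 * (n : ℝ) ^ Q.c) ^ 2 := by gcongr
      _ = 16 * (n : ℝ) ^ (2 * Q.c) := by ring
  have h2 : (48 : ℝ) * (n : ℝ) ^ (2 * Q.c) ≤ (n : ℝ) ^ Q.e := by
    have hn48 : (48 : ℝ) ≤ n := by exact_mod_cast (show 48 ≤ n by omega)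
    have he : Q.e = 2 * Q.c + (Q.c * Q.δ + 1) := by unfold e; ring
    rw [he, pow_add]
    have h3 : (48 : ℝ) ≤ (n : ℝ) ^ (Q.c * Q.δ + 1) := by
      calc (48 : ℝ) ≤ n := hn48
        _ = (n : ℝ) ^ 1 := (pow_one _).symm
        _ ≤ (n : ℝ) ^ (Q.c * Q.δ + 1) := pow_le_pow_right₀ (by linarith) (by omega)
    nlinarith [pow_nonneg hn0.le (2 * Q.c)]
  nlinarith

/-- **Security margin**: `4/n^{α'/2} < 1/N^δ` on the designed range, for large `n` (`δ ≥ 1`). [folklore] -/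
theorem security_margin (hc : 1 ≤ Q.c) (hδ : 1 ≤ Q.δ) {n N : ℕ} (hn : 4 * (5 * 2 ^ Q.c) ^ Q.δ < n) (hn1 : 1 ≤ n)
    (hN : N < Q.seedLen (n + 1)) (hN1 : 1 ≤ N) : 4 / (n : ℝ) ^ ((Q.α' : ℝ) / 2) < 1 / (N : ℝ) ^ Q.δ := by
  rw [Q.rpow_α']
  have hn0 : (0 : ℝ) < n := by exact_mod_cast (show 0 < n by omega)
  have hNr : (0 : ℝ) < N := by exact_mod_cast (show 0 < N by omega)
  have hn1r : (1 : ℝ) ≤ n := by exact_mod_cast hn1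
  rw [div_lt_div_iff₀ (by positivity) (by positivity), one_mul]
  have h1 : (N : ℝ) < 5 * 2 ^ Q.c * (n : ℝ) ^ Q.c := by
    have := Q.seedLen_succ_le hc n
    have h2 : (N : ℝ) < 5 * ((n : ℝ) + 1) ^ Q.c := by exact_mod_cast (lt_of_lt_of_le hN this)
    have h3 : ((n : ℝ) + 1) ^ Q.c ≤ (2 * (n : ℝ)) ^ Q.c := pow_le_pow_left₀ (by positivity) (by linarith) _
    calc (N : ℝ) < 5 * ((n : ℝ) + 1) ^ Q.c := h2
      _ ≤ 5 * (2 * (n : ℝ)) ^ Q.c := by gcongr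
      _ = 5 * 2 ^ Q.c * (n : ℝ) ^ Q.c := by rw [mul_pow]; ring
  have h4 : (N : ℝ) ^ Q.δ < (5 * 2 ^ Q.c) ^ Q.δ * (n : ℝ) ^ (Q.c * Q.δ) := by
    calc (N : ℝ) ^ Q.δ < (5 * 2 ^ Q.c * (n : ℝ) ^ Q.c) ^ Q.δ := pow_lt_pow_left₀ h1 hNr.le (by omega)
      _ = (5 * 2 ^ Q.c) ^ Q.δ * (n : ℝ) ^ (Q.c * Q.δ) := by rw [mul_pow, ← pow_mul]
  have he : Q.e = Q.c * Q.δ + (2 * Q.c + 1) := by unfold e; ring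
  have h5 : 4 * ((5 * 2 ^ Q.c) ^ Q.δ * (n : ℝ) ^ (Q.c * Q.δ)) ≤ (n : ℝ) ^ Q.e := by
    rw [he, pow_add]
    have h6 : (4 : ℝ) * (5 * 2 ^ Q.c) ^ Q.δ ≤ (n : ℝ) ^ (2 * Q.c + 1) := by
      have : (4 : ℝ) * (5 * 2 ^ Q.c) ^ Q.δ < n := by exact_mod_cast hn
      calc (4 : ℝ) * (5 * 2 ^ Q.c) ^ Q.δ ≤ n := this.le
        _ = (n : ℝ) ^ 1 := (pow_one _).symm
        _ ≤ (n : ℝ) ^ (2 * Q.c + 1) := pow_le_pow_right₀ hn1r (by omega)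
    nlinarith [pow_nonneg hn0.le (Q.c * Q.δ)]
  nlinarith

end CondParams

end Arith

/-! ### Generic entropy bookkeeping: congruence, reindexing, post-processing, truncation

The first three are one-line aliases of the Mathlib-only
`Literature/InformationTheory/Entropy/MapEntropy.lean` (2026-08-15). -/

section EntropyLemmas

variable {ι κ β β' : Type*} [DecidableEq β] [DecidableEq β']

/-- `mapEntropy` only depends on the values of the map on the set.  Alias (for this tree's
`Literature.Computability.Cryptography.mapEntropy`, definitionally the information-theory one) of
`Literature.InformationTheory.Entropy.mapEntropy_congr`. [folklore] -/
theorem mapEntropy_congr {S : Finset ι} {f g : ι → β} (h : ∀ v ∈ S, f v = g v) : mapEntropy S f = mapEntropy S g :=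
  Literature.InformationTheory.Entropy.mapEntropy_congr h

/-- **Reindexing**: `mapEntropy (W.image h) f = mapEntropy W (f ∘ h)` for `h` injective.  Alias of
`Literature.InformationTheory.Entropy.mapEntropy_image`. [folklore] -/
theorem mapEntropy_image [DecidableEq ι] {W : Finset κ} {h : κ → ι} (hh : Function.Injective h) (f : ι → β) :
    mapEntropy (W.image h) f = mapEntropy W (f ∘ h) :=
  Literature.InformationTheory.Entropy.mapEntropy_image hh f

/-- **Post-processing does not increase entropy**: `H(g(f(U_S))) ≤ H(f(U_S))` (fibres only grow).
Alias of `Literature.InformationTheory.Entropy.mapEntropy_comp_le`.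
[Cover–Thomas, 2nd ed., Problem 2.4 / data processing] [folklore] -/
theorem mapEntropy_comp_le (S : Finset ι) (f : ι → β) (g : β → β') : mapEntropy S (g ∘ f) ≤ mapEntropy S f :=
  Literature.InformationTheory.Entropy.mapEntropy_comp_le S f g

/-- Strings of a fixed length with a prescribed prefix: at most `2^{M-L}` of the strings of length
`M` have a given `L`-prefix. [folklore] -/
theorem card_filter_take_eq_le (T : Finset (List Bool)) {M L : ℕ} (hT : ∀ y ∈ T, y.length = M) (z : List Bool) :
    (T.filter fun y => y.take L = z).card ≤ 2 ^ (M - L) := by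
  classical
  have hinj : Set.InjOn (fun y : List Bool => (⟨(y.drop L ++ List.replicate (M - L) false).take (M - L), by simp⟩ : List.Vector Bool (M - L)))
      ↑(T.filter fun y => y.take L = z) := by
    intro y hy y' hy' h
    simp only [Finset.coe_filter, Set.mem_setOf_eq] at hy hy'
    have hl : (y.drop L).length = M - L := by simp [hT y hy.1]
    have hl' : (y'.drop L).length = M - L := by simp [hT y' hy'.1]
    have h2 := congrArg List.Vector.toList h
    simp only [List.Vector.toList_mk] at h2
    rw [List.take_left' hl, List.take_left' hl'] at h2
    rw [← List.take_append_drop L y, ← List.take_append_drop L y', hy.2, hy'.2, h2]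
  calc (T.filter fun y => y.take L = z).card
      ≤ (Finset.univ : Finset (List.Vector Bool (M - L))).card := Finset.card_le_card_of_injOn _ (fun y _ => Finset.mem_univ _) hinj
    _ = 2 ^ (M - L) := by rw [Finset.card_univ, card_vector, Fintype.card_bool]

/-- **Truncation costs at most the dropped bits**: if `f` has output length `M` on the nonempty `S`
and `L ≤ M`, then `H((f ·) ↾ L) ≥ H(f) - (M - L)`. [Y. Liu, R. Pass, FOCS 2020, proof of Thm 5.2
(truncations `G^c`); Cover–Thomas Problem 2.4] [folklore] -/
theorem mapEntropy_take_ge {S : Finset ι} (hS : S.Nonempty) (f : ι → List Bool) {M L : ℕ}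
    (hM : ∀ v ∈ S, (f v).length = M) :
    mapEntropy S f - ((M - L : ℕ) : ℝ) ≤ mapEntropy S ((fun y => y.take L) ∘ f) := by
  classical
  refine mapEntropy_sub_le_mapEntropy_comp hS f (fun y => y.take L) (M - L) fun z => ?_
  exact card_filter_take_eq_le (S.image f) (fun y hy => by
    obtain ⟨v, hv, rfl⟩ := Finset.mem_image.1 hy; exact hM v hv) z

end EntropyLemmas

/-! ### Thm 5.5: the entropy of the generator -/

section Thm55

namespace CondParams

variable (Q : CondParams) (S : ∀ n : ℕ, Finset (List.Vector Bool n))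

/-- The standing hypotheses of Thm 5.5 about the block data: the parameters, the regularity index,
the density of `S`, and the length and density clauses of Lemma 5.3. [Y. Liu, R. Pass, FOCS 2020,
proof of Thm 5.5] [folklore] -/
structure Hyps : Prop where
  /-- `c ≥ 1` [folklore] -/
  hc : 1 ≤ Q.c
  /-- `r n ≤ n` (so the index fits in the field) [folklore] -/
  hr : ∀ n, Q.r n ≤ n
  /-- density of `S`: `|S_n| ≥ 2ⁿ/n` [folklore] -/
  hS : ∀ n, 1 ≤ n → 2 ^ n ≤ n * (S n).card
  /-- nominal output lengths of `f'_{r(n)}` and `GL` on the seeds (Lemma 5.3) [folklore] -/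
  hlen : ∀ᶠ n in atTop, ∀ w ∈ lpSeeds S Q.c n, (Q.F (Q.r n) w).length = Q.ℓ n ∧ (Q.Hc w).length = Q.γ' * Nat.log 2 n
  /-- density (Lemma 5.3) [folklore] -/
  hdens : ∀ᶠ n in atTop,
    ((condUniform (lpSeeds S Q.c n)).map (Q.F (Q.r n))).tvDist (uniformBits (Q.ℓ n)) ≤ 3 / (n : ℝ) ^ ((Q.α' : ℝ) / 2)

variable {Q S}

/-- `S_n` is nonempty for `n ≥ 1`. [folklore] -/
theorem Hyps.nonempty (H : Q.Hyps S) {n : ℕ} (hn : 1 ≤ n) : (S n).Nonempty := by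
  have h := H.hS n hn
  rw [Finset.nonempty_iff_ne_empty]
  intro he
  rw [he, Finset.card_empty, Nat.mul_zero] at h
  have := Nat.one_le_two_pow (n := n)
  omega

/-- The eventual "large `n`" package used by the entropy and security estimates. [folklore] -/
theorem Hyps.eventually_good (H : Q.Hyps S) : ∃ n₀ : ℕ, ∀ n, n₀ ≤ n →
    (∀ w ∈ lpSeeds S Q.c n, (Q.F (Q.r n) w).length = Q.ℓ n ∧ (Q.Hc w).length = Q.γ' * Nat.log 2 n) ∧
    ((condUniform (lpSeeds S Q.c n)).map (Q.F (Q.r n))).tvDist (uniformBits (Q.ℓ n)) ≤ 3 / (n : ℝ) ^ ((Q.α' : ℝ) / 2) ∧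
    2 ^ (2 * Q.α' + 1 + 6) ≤ n := by
  obtain ⟨n₀, h⟩ := eventually_atTop.1 (H.hlen.and (H.hdens.and (eventually_ge_atTop (2 ^ (2 * Q.α' + 1 + 6)))))
  exact ⟨n₀, fun n hn => h n hn⟩

/-- From `N ≥ seedLen n₁`: the block length is at least `n₁`, and `N` lies in its designed range. [folklore] -/
theorem nOfS_ge (hc : 1 ≤ Q.c) {n₁ N : ℕ} (hN : Q.seedLen n₁ ≤ N) :
    n₁ ≤ Q.nOfS N ∧ Q.seedLen (Q.nOfS N) ≤ N ∧ N < Q.seedLen (Q.nOfS N + 1) := by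
  have hN1 : 1 ≤ N := by have := Q.le_seedLen n₁; unfold seedLen b at hN; omega
  have h1 := Q.seedLen_nOfS_le hc hN1
  have h2 := Q.lt_seedLen_succ N
  refine ⟨?_, h1, h2⟩
  by_contra hlt
  push Not at hlt
  have : Q.seedLen (Q.nOfS N + 1) ≤ Q.seedLen n₁ := Q.seedLen_strictMono.monotone (by omega)
  omega

/-- **Thm 5.5, entropy-preserving**: for all large `N`,
`H(G(U_N | E_N)) ≥ N - (γ' + 2) log₂ N`. [Y. Liu, R. Pass, FOCS 2020, proof of Thm 5.5
("the entropy loss of `G_{δ,γ}` is `n' - (ℓ(n) - 2) ≤ (2α'+4) log n'`" together with the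
extension to all lengths)] [cite: LiuPassFOCS2020, Thm 5.5 (proof)] -/
theorem entropy_G (H : Q.Hyps S) :
    ∀ᶠ N : ℕ in atTop, (N : ℝ) - ((Q.γ' + 2 : ℕ) : ℝ) * Real.logb 2 N ≤ mapEntropy (Q.E S N) Q.G := by
  classical
  obtain ⟨n₀, hn₀⟩ := H.eventually_good
  set n₁ := max n₀ 2 with hn₁
  filter_upwards [eventually_ge_atTop (Q.seedLen n₁)] with N hN
  obtain ⟨hn, hr1, hr2⟩ := nOfS_ge H.hc hN
  set n := Q.nOfS N with hndef
  obtain ⟨hlen, hdens, hbig⟩ := hn₀ n (le_trans (le_max_left _ _) hn)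
  have hn2 : 2 ≤ n := le_trans (le_max_right _ _) hn
  have hn1 : 1 ≤ n := by omega
  have hSn : (S n).Nonempty := H.nonempty hn1
  -- abbreviations
  set W := lpSeeds S Q.c n with hW
  set T := Q.core S n with hT
  set bx := Q.extra N with hbx
  set sl := Q.seedLen n with hsl
  set L := lpInner Q.γ N with hL
  set M := Q.outLen N with hM
  have hWne : W.Nonempty := lpSeeds_nonempty S hSn
  have hTne : T.Nonempty := Q.core_nonempty S hSn
  have hE : Q.E S N = padSeeds T bx := by unfold E; rw [if_pos ⟨hSn, hr1⟩]
  have hTlen : ∀ v ∈ T, v.length = sl := fun v hv => Q.length_of_mem_core S hv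
  have hGc : ∀ v ∈ T, (Q.Gcore n v).length = Q.ℓ' n := fun v _ => Q.length_Gcore n v
  have hM' : M = Q.ℓ' n + bx := rfl
  have hLM : L ≤ M := Q.lpInner_le_outLen H.hc hbig hr1 hr2
  have hN1 : 1 ≤ N := le_trans hn1 (le_trans (Q.le_seedLen n) hr1)
  -- Step 0: on `E_N`, `G` is the truncated padded core generator
  have hG : ∀ u ∈ Q.E S N, Q.G u = ((fun y => y.take L) ∘ padGen (Q.Gcore n) sl) u := by
    intro u hu
    have hul : u.length = N := ((Q.E_spec S N).2 u hu)
    simp only [G, Function.comp_apply, hul, ← hndef]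
    rfl
  rw [mapEntropy_congr hG, hE]
  -- Step 1: truncation
  have hpadlen : ∀ u ∈ padSeeds T bx, (padGen (Q.Gcore n) sl u).length = M := by
    intro u hu
    obtain ⟨v, hv, τ, hτ, rfl⟩ := mem_padSeeds.1 hu
    rw [padGen_append _ (hTlen v hv), List.length_append, hGc v hv, hτ, hM']
  have step1 := mapEntropy_take_ge (padSeeds_nonempty hTne bx) (padGen (Q.Gcore n) sl) hpadlen (L := L)
  -- Step 2: padding adds `bx`
  have step2 : mapEntropy (padSeeds T bx) (padGen (Q.Gcore n) sl) = mapEntropy T (Q.Gcore n) + bx :=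
    mapEntropy_padSeeds hTne hTlen (Q.Gcore n) hGc bx
  -- Step 3: reindex by the constant prefix
  have hpre_inj : Function.Injective fun w : List Bool => Complexity.natBits (b n) (Q.r n) ++ w := fun w w' h => List.append_cancel_left h
  have step3 : mapEntropy T (Q.Gcore n) = mapEntropy W (Q.Gcore n ∘ fun w => Complexity.natBits (b n) (Q.r n) ++ w) := by
    rw [hT, core, mapEntropy_image hpre_inj]
  -- Step 4: on `W` the core generator is `F ‖ Hc`
  have hrn : Q.r n < 2 ^ b n := lt_of_le_of_lt (H.hr n) (Nat.lt_pow_succ_log_self (by norm_num) n)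
  have step4 : mapEntropy W (Q.Gcore n ∘ fun w => Complexity.natBits (b n) (Q.r n) ++ w) = mapEntropy W fun w => Q.F (Q.r n) w ++ Q.Hc w :=
    mapEntropy_congr fun w hw => by
      simp only [Function.comp_apply]
      exact Q.Gcore_core hrn (hlen w hw).1 (hlen w hw).2
  -- Step 5: dropping `Hc`
  have step5 : mapEntropy W (Q.F (Q.r n)) ≤ mapEntropy W fun w => Q.F (Q.r n) w ++ Q.Hc w := by
    have h := mapEntropy_comp_le W (fun w => Q.F (Q.r n) w ++ Q.Hc w) (fun y => y.take (Q.ℓ n))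
    rw [mapEntropy_congr (f := (fun y => y.take (Q.ℓ n)) ∘ fun w => Q.F (Q.r n) w ++ Q.Hc w) (g := Q.F (Q.r n))
      (fun w hw => by simp [List.take_left' (hlen w hw).1])] at h
    exact h
  -- Step 6: Lemma 2.2
  have hℓ4 : 4 ≤ Q.ℓ n := by
    have h1 := Q.ℓ_eq hbig
    have h2 := mul_log_add_le hbig
    rw [Nat.add_mul, one_mul] at h2
    have h3 : 2 ≤ n ^ Q.c := le_trans hn2 (by
      calc n = n ^ 1 := (pow_one n).symm
        _ ≤ n ^ Q.c := Nat.pow_le_pow_right hn1 H.hc)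
    omega
  have step6 : (Q.ℓ n : ℝ) - 2 ≤ mapEntropy W (Q.F (Q.r n)) := by
    refine le_mapEntropy_of_sdUnif_le hWne _ hℓ4 ?_
    rw [← tvDist_condUniform_map_eq_sdUnif hWne]
    exact hdens.trans (Q.density_margin H.hc hbig)
  -- assemble
  have hML : (((M - L : ℕ) : ℝ)) = (M : ℝ) - L := by push_cast [Nat.cast_sub hLM]; ring
  have hMr : (M : ℝ) = Q.ℓ n + Q.γ' * Nat.log 2 n + bx := by rw [hM']; unfold ℓ'; push_cast; ring
  have hchain : (L : ℝ) - Q.γ' * Nat.log 2 n - 2 ≤ mapEntropy (padSeeds T bx) ((fun y => y.take L) ∘ padGen (Q.Gcore n) sl) := by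
    rw [step2, step3, step4] at step1
    rw [hML, hMr] at step1
    linarith
  -- compare with `N - (γ'+2) log₂ N`
  have hNL : (N : ℝ) ≤ L := by
    have : (0 : ℝ) ≤ (Q.γ : ℝ) * (Nat.log 2 N : ℝ) := by positivity
    rw [hL]; unfold lpInner; push_cast; linarith
  have hN2 : (2 : ℝ) ≤ N := by
    have : 2 ≤ N := le_trans hn2 (le_trans (Q.le_seedLen n) hr1)
    exact_mod_cast this
  have hlogN1 : 1 ≤ Real.logb 2 N := by
    rw [Real.le_logb_iff_rpow_le (by norm_num) (by linarith), Real.rpow_one]; exact hN2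
  have hlogn : (Nat.log 2 n : ℝ) ≤ Real.logb 2 N := by
    calc (Nat.log 2 n : ℝ) ≤ Real.logb 2 n := Real.natLog_le_logb n 2
      _ ≤ Real.logb 2 N := Real.logb_le_logb_of_le (by norm_num) (by exact_mod_cast (show 0 < n by omega))
          (by exact_mod_cast (le_trans (Q.le_seedLen n) hr1))
  have hγ0 : (0 : ℝ) ≤ Q.γ' := Nat.cast_nonneg _
  calc (N : ℝ) - ((Q.γ' + 2 : ℕ) : ℝ) * Real.logb 2 N ≤ (L : ℝ) - Q.γ' * Nat.log 2 n - 2 := by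
        push_cast
        nlinarith [hNL, hlogN1, hlogn, hγ0]
    _ ≤ _ := hchain

end CondParams

end Thm55

/-! ### Thm 5.5: pseudorandomness — the reduction to Lemma 5.3's distinguishers -/

section Reduction

namespace CondParams

variable (Q : CondParams) (D' : RandAlg (List Bool) Bool) (qD : Polynomial ℕ)

/-- Strict bound `K_b(n)` on `D'`'s coin count on its inputs `⟨1^N, v⟩`, `|v| = N + γ⌊log₂ N⌋`,
`N < seedLen (n+1)` (`q_D` a monotone bound on `D'.coinLen`). [folklore] -/
def Kb (n : ℕ) : ℕ := qD.eval (2 * Q.seedLen (n + 1) + 2 + lpInner Q.γ (Q.seedLen (n + 1))) + 1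

/-- The modulus of the advice encoding: `seedLen(n+1) · K_b(n)`. [folklore] -/
def Base (n : ℕ) : ℕ := Q.seedLen (n + 1) * Q.Kb qD n

/-- **The reduction**: a distinguisher for Lemma 5.3's ensembles (security parameter `n`, samples of
length `ℓ'(n)`) from a distinguisher `D'` for the cond EP-PRG (security parameter `N`): decode the
advice `(N - seedLen n, κ)` from the number of coins, append `N - seedLen n` fresh coins `y` to the
sample, cut to `N + γ⌊log₂ N⌋`, and run `D'` on `⟨1^N, ·⟩` with the next `κ` coins. [Y. Liu, R. Pass,
FOCS 2020, proof of Thm 5.5 ("the pseudorandomness property of `G'` follows directly")] [folklore] -/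
noncomputable def redRun (inp coins : List Bool) : Bool :=
  D'.run (boolPair (unaryEncodeNat (Q.seedLen (boolUnpair inp).1.length
      + coins.length % Q.Base qD (boolUnpair inp).1.length / Q.Kb qD (boolUnpair inp).1.length))
    (((boolUnpair inp).2 ++ coins.take (coins.length % Q.Base qD (boolUnpair inp).1.length / Q.Kb qD (boolUnpair inp).1.length)).take
      (lpInner Q.γ (Q.seedLen (boolUnpair inp).1.length
        + coins.length % Q.Base qD (boolUnpair inp).1.length / Q.Kb qD (boolUnpair inp).1.length))))
    ((coins.drop (coins.length % Q.Base qD (boolUnpair inp).1.length / Q.Kb qD (boolUnpair inp).1.length)).take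
      (coins.length % Q.Base qD (boolUnpair inp).1.length % Q.Kb qD (boolUnpair inp).1.length))

/-- The reduction as a `RandAlg` with coin budget `cl`. [folklore] -/
noncomputable def red (cl : ℕ → ℕ) : RandAlg (List Bool) Bool where
  run := Q.redRun D' qD
  coinLen := cl

variable {Q D' qD}

/-- `K_b > 0`. [folklore] -/
theorem Kb_pos (n : ℕ) : 0 < Q.Kb qD n := Nat.succ_pos _

/-- **Decoding the advice**: on `⟨1ⁿ, z⟩` with `|coins| = bxv · K_b + κ + Base`, `κ < K_b`,
`bxv < seedLen (n+1)`. [folklore] -/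
theorem redRun_eq {n bxv κ : ℕ} (hκ : κ < Q.Kb qD n) (hb : bxv < Q.seedLen (n + 1)) (z coins : List Bool)
    (hc : coins.length = bxv * Q.Kb qD n + κ + Q.Base qD n) :
    Q.redRun D' qD (boolPair (unaryEncodeNat n) z) coins =
      D'.run (boolPair (unaryEncodeNat (Q.seedLen n + bxv)) ((z ++ coins.take bxv).take (lpInner Q.γ (Q.seedLen n + bxv))))
        ((coins.drop bxv).take κ) := by
  have hK := Kb_pos (Q := Q) (qD := qD) n
  have hadv : coins.length % Q.Base qD n = bxv * Q.Kb qD n + κ := by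
    rw [hc, Nat.add_mod_right, Nat.mod_eq_of_lt]
    unfold Base
    calc bxv * Q.Kb qD n + κ < bxv * Q.Kb qD n + Q.Kb qD n := by omega
      _ = (bxv + 1) * Q.Kb qD n := by ring
      _ ≤ Q.seedLen (n + 1) * Q.Kb qD n := Nat.mul_le_mul_right _ hb
  have h1 : (bxv * Q.Kb qD n + κ) / Q.Kb qD n = bxv := by
    rw [Nat.add_comm, Nat.add_mul_div_right _ _ hK, Nat.div_eq_of_lt hκ, Nat.zero_add]
  have h2 : (bxv * Q.Kb qD n + κ) % Q.Kb qD n = κ := by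
    rw [Nat.add_comm, Nat.add_mul_mod_self_right, Nat.mod_eq_of_lt hκ]
  have hn : (unaryEncodeNat n).length = n := unary_decode_encode_nat n
  simp only [redRun, boolUnpair_boolPair, hn, hadv, h1, h2]

/-- **The acceptance probability of the reduction** on `⟨1ⁿ, z⟩`: the average over the appended
coins `y` of `Pr[D'(1^N, (z ‖ y)↾L) = 1]`, `N = seedLen n + bxv`, `L = N + γ⌊log₂ N⌋`. [folklore] -/
theorem pr_red_eq {n bxv κ : ℕ} (hκ : κ < Q.Kb qD n) (hb : bxv < Q.seedLen (n + 1)) {cl : ℕ → ℕ} (z : List Bool)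
    (hcl : cl (boolPair (unaryEncodeNat n) z).length = bxv * Q.Kb qD n + κ + Q.Base qD n)
    (hκD : ∀ v : List Bool, v.length = lpInner Q.γ (Q.seedLen n + bxv) →
      D'.coinLen (boolPair (unaryEncodeNat (Q.seedLen n + bxv)) v).length = κ)
    (hz : lpInner Q.γ (Q.seedLen n + bxv) ≤ z.length + bxv) :
    (Q.red D' qD cl).pr id (boolPair (unaryEncodeNat n) z) {true} =
      uniformAvg bxv fun y => D'.pr id (boolPair (unaryEncodeNat (Q.seedLen n + bxv))
        ((z ++ y).take (lpInner Q.γ (Q.seedLen n + bxv)))) {true} := by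
  set N := Q.seedLen n + bxv with hN
  set L := lpInner Q.γ N with hL
  have hBase : bxv + κ ≤ Q.Base qD n := by
    unfold Base
    calc bxv + κ ≤ (bxv + 1) * (κ + 1) := by nlinarith
      _ ≤ Q.seedLen (n + 1) * Q.Kb qD n := Nat.mul_le_mul hb hκ
  set rest := bxv * Q.Kb qD n + κ + Q.Base qD n - (bxv + κ) with hrest
  have hsplit : bxv * Q.Kb qD n + κ + Q.Base qD n = bxv + (κ + rest) := by rw [hrest]; omega
  rw [(Q.red D' qD cl).pr_true_eq_uniformAvg id _ (κ := bxv + (κ + rest)) (by rw [id, show (Q.red D' qD cl).coinLen = cl from rfl, hcl, hsplit])]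
  have hrun : ∀ coins : List Bool, coins.length = bxv + (κ + rest) →
      (Q.red D' qD cl).run (boolPair (unaryEncodeNat n) z) coins =
        D'.run (boolPair (unaryEncodeNat N) ((z ++ coins.take bxv).take L)) ((coins.drop bxv).take κ) := by
    intro coins hc
    exact redRun_eq hκ hb z coins (by rw [hc, hsplit])
  set φ : List Bool → List Bool → ℝ := fun y r' =>
    if D'.run (boolPair (unaryEncodeNat N) ((z ++ y).take L)) (r'.take κ) = true then (1 : ℝ) else 0 with hφ
  have step : uniformAvg (bxv + (κ + rest)) (fun r => if (Q.red D' qD cl).run (boolPair (unaryEncodeNat n) z) r = true then (1 : ℝ) else 0) =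
      uniformAvg (bxv + (κ + rest)) (fun r => φ (r.take bxv) (r.drop bxv)) := by
    refine uniformAvg_congr fun r hr => ?_
    simp only [hrun r hr, hφ]
  rw [step, uniformAvg_add bxv (κ + rest) φ]
  refine uniformAvg_congr fun y hy => ?_
  have hlenv : ((z ++ y).take L).length = L := by
    rw [List.length_take, List.length_append, hy]; exact min_eq_left (by omega)
  have hpr := D'.pr_true_eq_uniformAvg id (boolPair (unaryEncodeNat N) ((z ++ y).take L)) (κ := κ) (hκD _ hlenv)
  rw [hpr]
  simp only [hφ]
  exact uniformAvg_take κ rest (fun r' => if D'.run (boolPair (unaryEncodeNat N) ((z ++ y).take L)) r' = true then (1 : ℝ) else 0)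


/-! #### The two acceptance probabilities of the reduction -/

variable {S : ∀ n : ℕ, Finset (List.Vector Bool n)}

/-- **On Lemma 5.3's distribution the reduction sees exactly `G(U_N | E_N)`.** [Y. Liu, R. Pass,
FOCS 2020, proof of Thm 5.5] [folklore] -/
theorem acceptPMF_red_cond (hc : 1 ≤ Q.c) {n bxv κ : ℕ} (hSn : (S n).Nonempty)
    (hκ : κ < Q.Kb qD n) (hb : Q.seedLen n + bxv < Q.seedLen (n + 1)) {cl : ℕ → ℕ}
    (hlen : ∀ w ∈ lpSeeds S Q.c n, (Q.F (Q.r n) w).length = Q.ℓ n ∧ (Q.Hc w).length = Q.γ' * Nat.log 2 n)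
    (hr : Q.r n ≤ n) (hbig : 2 ^ (2 * Q.α' + 1 + 6) ≤ n)
    (hcl : ∀ z : List Bool, z.length = Q.ℓ' n → cl (boolPair (unaryEncodeNat n) z).length = bxv * Q.Kb qD n + κ + Q.Base qD n)
    (hκD : ∀ v : List Bool, v.length = lpInner Q.γ (Q.seedLen n + bxv) →
      D'.coinLen (boolPair (unaryEncodeNat (Q.seedLen n + bxv)) v).length = κ) :
    (acceptPMF (Q.red D' qD cl) n ((condUniform (lpSeeds S Q.c n)).map fun w => Q.F (Q.r n) w ++ Q.Hc w) true).toReal =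
      (acceptPMF D' (Q.seedLen n + bxv) ((condUniform (Q.E S (Q.seedLen n + bxv))).map Q.G) true).toReal := by
  classical
  set N := Q.seedLen n + bxv with hN
  set L := lpInner Q.γ N with hL
  set W := lpSeeds S Q.c n with hW
  set T := Q.core S n with hT
  set h : List Bool → List Bool := fun w => Q.F (Q.r n) w ++ Q.Hc w with hh
  have hbxv : bxv < Q.seedLen (n + 1) := by omega
  have hnOf : Q.nOfS N = n := Q.nOfS_eq hc (Nat.le_add_right _ _) hb
  have hextra : Q.extra N = bxv := by unfold extra; rw [hnOf, hN]; omega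
  have hE : Q.E S N = padSeeds T bxv := by unfold E; rw [hnOf, if_pos ⟨hSn, Nat.le_add_right _ _⟩, hextra]
  have hWne : W.Nonempty := lpSeeds_nonempty S hSn
  have hTne : T.Nonempty := Q.core_nonempty S hSn
  have hTlen : ∀ v ∈ T, v.length = Q.seedLen n := fun v hv => Q.length_of_mem_core S hv
  have hLout : L ≤ Q.ℓ' n + bxv := by
    have := Q.lpInner_le_outLen hc hbig (Nat.le_add_right _ _) hb
    unfold outLen at this; rwa [hnOf, hextra] at this
  have hhlen : ∀ w ∈ W, (h w).length = Q.ℓ' n := fun w hw => by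
    simp only [hh, List.length_append, (hlen w hw).1, (hlen w hw).2, ℓ']
  have hrn : Q.r n < 2 ^ b n := lt_of_le_of_lt hr (Nat.lt_pow_succ_log_self (by norm_num) n)
  -- left-hand side
  rw [toReal_acceptPMF_condUniform_map _ _ hWne, hE, toReal_acceptPMF_condUniform_map _ _ (padSeeds_nonempty hTne bxv),
    card_padSeeds hTlen bxv, sum_padSeeds hTlen bxv]
  have hpre_inj : Function.Injective fun w : List Bool => Complexity.natBits (b n) (Q.r n) ++ w := fun w w' h => List.append_cancel_left h
  rw [hT, core, Finset.sum_image fun x _ y _ hxy => hpre_inj hxy, Finset.card_image_of_injective _ hpre_inj]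
  have hcardW : (0 : ℝ) < W.card := by exact_mod_cast hWne.card_pos
  push_cast
  rw [div_eq_div_iff hcardW.ne' (mul_ne_zero hcardW.ne' (by positivity))]
  rw [Finset.sum_mul, Finset.sum_mul]
  refine Finset.sum_congr rfl fun w hw => ?_
  -- the reduction's acceptance probability on `h w`
  rw [pr_red_eq hκ hbxv (h w) (hcl (h w) (hhlen w hw)) hκD (by rw [hhlen w hw]; exact hLout)]
  -- the generator on the padded designed seeds
  have hG : ∀ τ : List.Vector Bool bxv, Q.G (Complexity.natBits (b n) (Q.r n) ++ w ++ τ.toList) = (h w ++ τ.toList).take L := by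
    intro τ
    have hvT : Complexity.natBits (b n) (Q.r n) ++ w ∈ T := Finset.mem_image_of_mem _ hw
    have hul : (Complexity.natBits (b n) (Q.r n) ++ w ++ τ.toList).length = N := by
      rw [List.length_append, hTlen _ hvT, τ.toList_length, hN]
    simp only [G, hul, hnOf, padGen_append _ (hTlen _ hvT), Q.Gcore_core hrn (hlen w hw).1 (hlen w hw).2]
    rfl
  simp only [hG]
  unfold uniformAvg
  field_simp
  ring

/-- **On the uniform distribution the reduction sees `U_{N + γ⌊log₂ N⌋}`.** [folklore] -/
theorem acceptPMF_red_uniform (hc : 1 ≤ Q.c) {n bxv κ : ℕ} (hκ : κ < Q.Kb qD n) (hb : Q.seedLen n + bxv < Q.seedLen (n + 1))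
    {cl : ℕ → ℕ} (hbig : 2 ^ (2 * Q.α' + 1 + 6) ≤ n)
    (hcl : ∀ z : List Bool, z.length = Q.ℓ' n → cl (boolPair (unaryEncodeNat n) z).length = bxv * Q.Kb qD n + κ + Q.Base qD n)
    (hκD : ∀ v : List Bool, v.length = lpInner Q.γ (Q.seedLen n + bxv) →
      D'.coinLen (boolPair (unaryEncodeNat (Q.seedLen n + bxv)) v).length = κ) :
    (acceptPMF (Q.red D' qD cl) n (uniformBits (Q.ℓ' n)) true).toReal =
      (acceptPMF D' (Q.seedLen n + bxv) (uniformBits (lpInner Q.γ (Q.seedLen n + bxv))) true).toReal := by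
  set N := Q.seedLen n + bxv with hN
  set L := lpInner Q.γ N with hL
  have hbxv : bxv < Q.seedLen (n + 1) := by omega
  have hnOf : Q.nOfS N = n := Q.nOfS_eq hc (Nat.le_add_right _ _) hb
  have hLout : L ≤ Q.ℓ' n + bxv := by
    have := Q.lpInner_le_outLen hc hbig (Nat.le_add_right _ _) hb
    unfold outLen extra at this; rwa [hnOf, show Q.seedLen n + bxv - Q.seedLen n = bxv by omega] at this
  rw [toReal_acceptPMF_uniformBits, toReal_acceptPMF_uniformBits]
  have step1 : uniformAvg (Q.ℓ' n) (fun z => (Q.red D' qD cl).pr id (boolPair (unaryEncodeNat n) z) {true}) =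
      uniformAvg (Q.ℓ' n) (fun z => uniformAvg bxv fun y =>
        D'.pr id (boolPair (unaryEncodeNat N) ((z ++ y).take L)) {true}) := by
    refine uniformAvg_congr fun z hz => ?_
    exact pr_red_eq hκ hbxv z (hcl z hz) hκD (by rw [hz]; exact hLout)
  rw [step1, ← uniformAvg_add (Q.ℓ' n) bxv (fun z y => D'.pr id (boolPair (unaryEncodeNat N) ((z ++ y).take L)) {true})]
  simp only [List.take_append_drop]
  rw [show Q.ℓ' n + bxv = L + (Q.ℓ' n + bxv - L) by omega]
  exact uniformAvg_take L _ (fun v => D'.pr id (boolPair (unaryEncodeNat N) v) {true})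


/-! #### The coin budget (advice) and the contradiction -/

variable (Q D' qD)

/-- `D'` does well at some target length of block length `n`. [folklore] -/
def GoodLen (adv : ℕ → ℝ) (n : ℕ) : Prop :=
  ∃ bxv, Q.seedLen n + bxv < Q.seedLen (n + 1) ∧ 1 / ((Q.seedLen n + bxv : ℕ) : ℝ) ^ Q.δ ≤ adv (Q.seedLen n + bxv)

/-- The advised offset `bxv(n)` (else `0`). [folklore] -/
noncomputable def bxA (adv : ℕ → ℝ) (n : ℕ) : ℕ :=
  open scoped Classical in if h : Q.GoodLen adv n then Classical.choose h else 0

/-- The advised target seed length `N(n)`. [folklore] -/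
noncomputable def NA (adv : ℕ → ℝ) (n : ℕ) : ℕ := Q.seedLen n + Q.bxA adv n

/-- The advised coin count `κ(n)` of `D'`. [folklore] -/
noncomputable def κA (adv : ℕ → ℝ) (n : ℕ) : ℕ := D'.coinLen (2 * Q.NA adv n + 2 + lpInner Q.γ (Q.NA adv n))

/-- The coin budget encoding the advice. [folklore] -/
noncomputable def Code (adv : ℕ → ℝ) (n : ℕ) : ℕ := Q.bxA adv n * Q.Kb qD n + Q.κA D' adv n + Q.Base qD n

/-- The spread of the input lengths `|⟨1ⁿ, z⟩|`, `|z| = ℓ'(n)`. [folklore] -/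
def spread (n : ℕ) : ℕ := 2 * n + 2 + Q.ℓ' n

/-- The coin budget of the reduction (selected block lengths `Yao.sel`). [folklore] -/
noncomputable def cl (adv : ℕ → ℝ) (Gs : ℕ → Prop) (l : ℕ) : ℕ :=
  if Yao.sel Gs Q.spread l ≤ l then Q.Code D' qD adv (Yao.sel Gs Q.spread l) else 0

/-- A polynomial bound on the coin budget. [folklore] -/
noncomputable def clPoly : Polynomial ℕ :=
  (Polynomial.C 5 * (Polynomial.X + 1) ^ Q.c + 1) *
    (qD.comp (Polynomial.C (17 * (Q.γ + 1)) * (Polynomial.X + 1) ^ Q.c) + 1) * 3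

variable {Q D' qD}

/-- `n ≤ spread n`. [folklore] -/
theorem spread_ge (n : ℕ) : n ≤ Q.spread n := by unfold spread; omega

/-- The advised offset is in range. [folklore] -/
theorem bxA_lt (adv : ℕ → ℝ) (n : ℕ) : Q.seedLen n + Q.bxA adv n < Q.seedLen (n + 1) := by
  unfold bxA
  split_ifs with h
  · exact (Classical.choose_spec h).1
  · simpa using Q.seedLen_strictMono (Nat.lt_succ_self n)

/-- The advised target length is good at a good block length. [folklore] -/
theorem bxA_spec {adv : ℕ → ℝ} {n : ℕ} (h : Q.GoodLen adv n) :
    1 / ((Q.seedLen n + Q.bxA adv n : ℕ) : ℝ) ^ Q.δ ≤ adv (Q.seedLen n + Q.bxA adv n) := by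
  unfold bxA; rw [dif_pos h]; exact (Classical.choose_spec h).2

/-- `κ(n) < K_b(n)`. [folklore] -/
theorem κA_lt (hqD : ∀ m, D'.coinLen m ≤ qD.eval m) (adv : ℕ → ℝ) (n : ℕ) : Q.κA D' adv n < Q.Kb qD n := by
  unfold κA Kb
  have h1 : Q.NA adv n < Q.seedLen (n + 1) := bxA_lt adv n
  have h2 : lpInner Q.γ (Q.NA adv n) ≤ lpInner Q.γ (Q.seedLen (n + 1)) := lpInner_mono Q.γ h1.le
  exact Nat.lt_succ_of_le ((hqD _).trans (TM2Iter.eval_mono qD (by omega)))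

/-- `Code n ≤ clPoly(n)`. [folklore] -/
theorem Code_le (hc : 1 ≤ Q.c) (hqD : ∀ m, D'.coinLen m ≤ qD.eval m) (adv : ℕ → ℝ) (n : ℕ) :
    Q.Code D' qD adv n ≤ (Q.clPoly qD).eval n := by
  have hsl : Q.seedLen (n + 1) ≤ 5 * (n + 1) ^ Q.c := Q.seedLen_succ_le hc n
  have hb : Q.bxA adv n ≤ Q.seedLen (n + 1) := by have := bxA_lt (Q := Q) adv n; omega
  have hκ := (κA_lt (Q := Q) hqD adv n).le
  have hlp : lpInner Q.γ (Q.seedLen (n + 1)) ≤ (Q.γ + 1) * Q.seedLen (n + 1) := by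
    unfold lpInner
    have h0 := Nat.log_lt_self 2 (show Q.seedLen (n + 1) ≠ 0 by unfold seedLen b; omega)
    have h1 := Nat.mul_le_mul_left Q.γ h0.le
    have h2 : (Q.γ + 1) * Q.seedLen (n + 1) = Q.γ * Q.seedLen (n + 1) + Q.seedLen (n + 1) := by ring
    omega
  have hKb : Q.Kb qD n ≤ qD.eval (17 * (Q.γ + 1) * (n + 1) ^ Q.c) + 1 := by
    unfold Kb
    refine Nat.succ_le_succ (TM2Iter.eval_mono qD ?_)
    have hA : (Q.γ + 1) * Q.seedLen (n + 1) ≤ (Q.γ + 1) * (5 * (n + 1) ^ Q.c) := Nat.mul_le_mul_left _ hsl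
    have h5 : (Q.γ + 1) * (5 * (n + 1) ^ Q.c) = 5 * ((Q.γ + 1) * (n + 1) ^ Q.c) := by ring
    have h17 : 17 * (Q.γ + 1) * (n + 1) ^ Q.c = 17 * ((Q.γ + 1) * (n + 1) ^ Q.c) := by ring
    have hγP : (n + 1) ^ Q.c ≤ (Q.γ + 1) * (n + 1) ^ Q.c := Nat.le_mul_of_pos_left _ (by omega)
    have hB : 1 ≤ (n + 1) ^ Q.c := Nat.one_le_pow _ _ (Nat.succ_pos n)
    omega
  have heval : (Q.clPoly qD).eval n = (5 * (n + 1) ^ Q.c + 1) * (qD.eval (17 * (Q.γ + 1) * (n + 1) ^ Q.c) + 1) * 3 := by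
    simp [clPoly, Polynomial.eval_comp]
  rw [heval]
  unfold Code Base
  set A := 5 * (n + 1) ^ Q.c + 1
  set K := qD.eval (17 * (Q.γ + 1) * (n + 1) ^ Q.c) + 1
  have h1 : Q.bxA adv n * Q.Kb qD n ≤ A * K := Nat.mul_le_mul (by omega) hKb
  have h2 : Q.κA D' adv n ≤ A * K := hκ.trans (hKb.trans (Nat.le_mul_of_pos_left K (by omega)))
  have h3 : Q.seedLen (n + 1) * Q.Kb qD n ≤ A * K := Nat.mul_le_mul (by omega) hKb
  omega

/-- The coin budget is polynomially bounded. [folklore] -/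
theorem cl_le (hc : 1 ≤ Q.c) (hqD : ∀ m, D'.coinLen m ≤ qD.eval m) (adv : ℕ → ℝ) (Gs : ℕ → Prop) (l : ℕ) :
    Q.cl D' qD adv Gs l ≤ (Q.clPoly qD).eval l := by
  unfold cl
  split_ifs with h
  · exact (Code_le hc hqD adv _).trans (TM2Iter.eval_mono _ h)
  · exact Nat.zero_le _

/-- On the inputs `⟨1ⁿ, z⟩`, `|z| = ℓ'(n)`, of a selected block length the budget is `Code n`. [folklore] -/
theorem cl_eq {adv : ℕ → ℝ} {Gs : ℕ → Prop} (hG : ∀ a, ∃ b, a ≤ b ∧ Gs b) (j : ℕ) {z : List Bool}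
    (hz : z.length = Q.ℓ' (Yao.seqN Gs Q.spread j)) :
    Q.cl D' qD adv Gs (boolPair (unaryEncodeNat (Yao.seqN Gs Q.spread j)) z).length = Q.Code D' qD adv (Yao.seqN Gs Q.spread j) := by
  set n := Yao.seqN Gs Q.spread j
  have hℓ : (boolPair (unaryEncodeNat n) z).length = Q.spread n := by
    rw [length_boolPair, show (unaryEncodeNat n).length = n from unary_decode_encode_nat n, hz, spread]
  have hsel : Yao.sel Gs Q.spread (boolPair (unaryEncodeNat n) z).length = n :=
    Yao.sel_eq hG spread_ge (by rw [hℓ]; exact spread_ge n) (by rw [hℓ])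
  unfold cl
  rw [hsel, if_pos (by rw [hℓ]; exact spread_ge n)]

/-- **Thm 5.5, pseudorandomness**: `G(U_N | E_N)` is `1/N^δ`-indistinguishable from `U_{N+γ⌊log₂ N⌋}`
by PPT distinguishers, given Lemma 5.3's pseudorandomness at block lengths and the efficiency of
the reduction. [Y. Liu, R. Pass, FOCS 2020, proof of Thm 5.5 ("`4/n^{α'/2} ≤ 1/n'(n)^δ` for
sufficiently large `n`")] [cite: LiuPassFOCS2020, Thm 5.5 (proof)] -/
theorem pseudorandom_G (H : Q.Hyps S) (hδ : 1 ≤ Q.δ)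
    (hpr : ∀ D : RandAlg (List Bool) Bool, IsPPT D encodeBool → ∀ᶠ n in atTop,
      distAdvantage D (fun n => (condUniform (lpSeeds S Q.c n)).map fun w => Q.F (Q.r n) w ++ Q.Hc w)
        (uniformEnsemble Q.ℓ') n ≤ 4 / (n : ℝ) ^ ((Q.α' : ℝ) / 2))
    (hred : ∀ (D' : RandAlg (List Bool) Bool) (qD : Polynomial ℕ) (cl : ℕ → ℕ), IsPPT D' encodeBool →
      (∀ m, D'.coinLen m ≤ qD.eval m) → (∃ pc : Polynomial ℕ, ∀ l, cl l ≤ pc.eval l) → IsPPT (Q.red D' qD cl) encodeBool)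
    (D' : RandAlg (List Bool) Bool) (hD' : IsPPT D' encodeBool) :
    ∀ᶠ N in atTop, distAdvantage D' (condEnsemble Q.G (Q.E S)) (uniformEnsemble (lpInner Q.γ)) N < 1 / (N : ℝ) ^ Q.δ := by
  by_contra hne
  rw [Filter.not_eventually] at hne
  simp only [not_lt] at hne
  set adv : ℕ → ℝ := fun N => distAdvantage D' (condEnsemble Q.G (Q.E S)) (uniformEnsemble (lpInner Q.γ)) N with hadv
  obtain ⟨qD, hqD⟩ := hD'.2
  -- good block lengths are frequent
  have hgood : ∃ᶠ n in atTop, Q.GoodLen adv n := by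
    have h1 : ∃ᶠ N in atTop, Q.GoodLen adv (Q.nOfS N) := by
      refine (hne.and_eventually (eventually_ge_atTop 1)).mono fun N hN => ?_
      obtain ⟨hGN, hN1⟩ := hN
      refine ⟨N - Q.seedLen (Q.nOfS N), ?_, ?_⟩
      · rw [Nat.add_sub_cancel' (Q.seedLen_nOfS_le H.hc hN1)]; exact Q.lt_seedLen_succ N
      · rw [Nat.add_sub_cancel' (Q.seedLen_nOfS_le H.hc hN1)]; exact hGN
    exact Q.tendsto_nOfS.frequently h1
  obtain ⟨n₀, hn₀⟩ := H.eventually_good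
  set Gs : ℕ → Prop := fun n => Q.GoodLen adv n ∧ n₀ ≤ n ∧ 4 * (5 * 2 ^ Q.c) ^ Q.δ < n ∧ 2 ≤ n with hGs
  have hGsf : ∃ᶠ n in atTop, Gs n :=
    (hgood.and_eventually ((eventually_ge_atTop n₀).and ((eventually_gt_atTop _).and (eventually_ge_atTop 2))))
  have hG' : ∀ a, ∃ b, a ≤ b ∧ Gs b := fun a => by
    obtain ⟨b, hb, hGb⟩ := frequently_atTop.1 hGsf a
    exact ⟨b, hb, hGb⟩
  -- the reduction with the advice-carrying coin budget
  have hPPT : IsPPT (Q.red D' qD (Q.cl D' qD adv Gs)) encodeBool :=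
    hred D' qD _ hD' hqD ⟨Q.clPoly qD, cl_le H.hc hqD adv Gs⟩
  obtain ⟨N₁, hN₁⟩ := eventually_atTop.1 (hpr _ hPPT)
  set n := Yao.seqN Gs Q.spread N₁ with hn
  have hNn : N₁ ≤ n := (Yao.seqN_strictMono hG' spread_ge).id_le N₁
  obtain ⟨hgoodn, hn0, hsec, hn2⟩ := Yao.seqN_good hG' N₁
  obtain ⟨hlen, -, hbig⟩ := hn₀ n hn0
  have hn1 : 1 ≤ n := by omega
  have hb : Q.seedLen n + Q.bxA adv n < Q.seedLen (n + 1) := bxA_lt adv n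
  have hκlt : (Q.κA D' adv n) < Q.Kb qD n := κA_lt hqD adv n
  have hcl : ∀ z : List Bool, z.length = Q.ℓ' n →
      Q.cl D' qD adv Gs (boolPair (unaryEncodeNat n) z).length = Q.bxA adv n * Q.Kb qD n + (Q.κA D' adv n) + Q.Base qD n :=
    fun z hz => cl_eq hG' N₁ hz
  have hκD : ∀ v : List Bool, v.length = lpInner Q.γ (Q.seedLen n + Q.bxA adv n) →
      D'.coinLen (boolPair (unaryEncodeNat (Q.seedLen n + Q.bxA adv n)) v).length = (Q.κA D' adv n) := by
    intro v hv
    rw [length_boolPair, show (unaryEncodeNat (Q.seedLen n + Q.bxA adv n)).length = Q.seedLen n + Q.bxA adv n from unary_decode_encode_nat _, hv]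
    rfl
  have hSn : (S n).Nonempty := H.nonempty hn1
  -- the two advantages coincide
  have heq : distAdvantage (Q.red D' qD (Q.cl D' qD adv Gs))
        (fun n => (condUniform (lpSeeds S Q.c n)).map fun w => Q.F (Q.r n) w ++ Q.Hc w) (uniformEnsemble Q.ℓ') n = adv (Q.seedLen n + Q.bxA adv n) := by
    show _ = distAdvantage D' (condEnsemble Q.G (Q.E S)) (uniformEnsemble (lpInner Q.γ)) (Q.seedLen n + Q.bxA adv n)
    simp only [distAdvantage, condEnsemble, uniformEnsemble]
    rw [acceptPMF_red_cond H.hc hSn hκlt hb hlen (H.hr n) hbig hcl hκD, acceptPMF_red_uniform H.hc hκlt hb hbig hcl hκD]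
  have h1 : 1 / ((Q.seedLen n + Q.bxA adv n : ℕ) : ℝ) ^ Q.δ ≤ adv (Q.seedLen n + Q.bxA adv n) := bxA_spec hgoodn
  have h2 := hN₁ n hNn
  rw [heq] at h2
  have hN1 : 1 ≤ Q.seedLen n + Q.bxA adv n := le_trans hn1 (le_trans (Q.le_seedLen n) (Nat.le_add_right _ _))
  have h3 := Q.security_margin H.hc hδ hsec hn1 hb hN1
  linarith

end CondParams

end Reduction

/-! ### Thm 5.5 assembled from Lemma 5.3 and the two efficiency facts -/

section Assembly

/-- **Efficiency of the generator of Thm 5.5** (named fact, D-0014): for a polynomial-time family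
`(i, w) ↦ f'_i(w)` (index in unary) and a polynomial-time `GL`, the generator `CondParams.G` —
find the designed prefix length, read the index field, call `f'_i` and `GL`, force the nominal
lengths, pass the rest of the seed through and cut to `N + γ⌊log₂ N⌋` — is polynomial-time
computable. Print: "`G'_{δ,γ}` runs in `poly(n) + O(n^{c+1}) + (γ+δ)O(n^c log n)` time". To be
discharged with the `FP` toolkit (`PlumbingBricks.lean`). [Y. Liu, R. Pass, FOCS 2020, proof of
Thm 5.5 (running time)] [cite: LiuPassFOCS2020, Thm 5.5 (proof)] -/
def condGen_polyTime : Prop :=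
  ∀ Q : CondParams, 1 ≤ Q.c → PolyTimeComputable id id (fun z => Q.F (boolUnpair z).1.length (boolUnpair z).2) →
    PolyTimeComputable id id Q.Hc → PolyTimeComputable id id Q.G

/-- **Efficiency of the reduction of Thm 5.5** (named fact, D-0014): for a PPT `D'`, the run
function `CondParams.redRun` — decode `(N - seedLen n, κ)` from the number of coins, append coins to
the sample, cut, and run `D'` once — is polynomial-time on the pair presentation of (input, coins)
(the time core of `IsPPT`; the coin budget is arbitrary polynomially bounded, `isPPT_red_of`).
Print: "the pseudorandomness property of `G'_{δ,γ}` follows directly". To be discharged with the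
`FP` toolkit. [Y. Liu, R. Pass, FOCS 2020, proof of Thm 5.5] [cite: LiuPassFOCS2020, Thm 5.5 (proof)] -/
def condRedRun_polyTime : Prop :=
  ∀ (Q : CondParams) (D' : RandAlg (List Bool) Bool) (qD : Polynomial ℕ), IsPPT D' encodeBool →
    PolyTimeComputable (fun p : List Bool × List Bool => boolPair p.1 p.2) encodeBool (Function.uncurry (Q.redRun D' qD))

/-- From the run-core fact: the reduction with any polynomially bounded coin budget is PPT. [folklore] -/
theorem CondParams.isPPT_red_of (h : condRedRun_polyTime) (Q : CondParams) (D' : RandAlg (List Bool) Bool)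
    (qD : Polynomial ℕ) (cl : ℕ → ℕ) (hD' : IsPPT D' encodeBool) (hcl : ∃ pc : Polynomial ℕ, ∀ l, cl l ≤ pc.eval l) :
    IsPPT (Q.red D' qD cl) encodeBool :=
  ⟨h Q D' qD hD', hcl⟩

/-- The regularity index never exceeds the length. [folklore] -/
theorem lpRegIdx_le (f : List Bool → List Bool) (n : ℕ) : lpRegIdx f n ≤ n := by
  rcases Nat.eq_zero_or_pos n with rfl | hn
  · unfold lpRegIdx; simp
  · exact (lpRegIdx_mem (f := f) hn).2

/-- Output length of `G` on every seed of a large length. [folklore] -/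
theorem CondParams.length_G (Q : CondParams) (hc : 1 ≤ Q.c) :
    ∀ᶠ N in atTop, ∀ u : List Bool, u.length = N → (Q.G u).length = lpInner Q.γ N := by
  filter_upwards [eventually_ge_atTop (Q.seedLen (2 ^ (2 * Q.α' + 1 + 6)))] with N hN u hu
  obtain ⟨hn, hr1, hr2⟩ := CondParams.nOfS_ge hc hN
  have hstretch := Q.lpInner_le_outLen hc hn hr1 hr2
  unfold CondParams.outLen CondParams.extra at hstretch
  simp only [CondParams.G, hu, List.length_take, padGen, List.length_append, Q.length_Gcore, List.length_drop,
    List.length_take]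
  rw [min_eq_left (by omega)]

/-- **Liu–Pass Thm 5.5 from Lemma 5.3** (and the two efficiency facts): OWFs give, for all
`γ, δ > 1`, a `1/n^δ`-cond EP-PRG of stretch `γ⌊log₂ n⌋` — the tree's named fact
`condEPPRG_of_OWFExist` (`LiuPassPadding.lean`). Proof as printed: Lemma 5.4 (`LiuPassRegular.lean`,
`LiuPassSOWF.lean`: every OWF is a regular `S`-OWF on the dense `S_n = lpRegSet f n`), Lemma 5.3
(the fact `liuPass_lemma53`), the generator `G_{δ,γ}(i, x, σ) = f'_i(x,σ) ‖ GL(x,σ)` with the events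
`E = {i = r(n), x ∈ S_n}` extended to all seed lengths by passing extra bits through, entropy via
Lemma 2.2 (`le_mapEntropy_of_sdUnif_le`) and pseudorandomness via the reduction `CondParams.red`.
[Y. Liu, R. Pass, FOCS 2020, Thm 5.5] [cite: LiuPassFOCS2020, Thm 5.5] -/
theorem condEPPRG_of_OWFExist_of_lemma53 (h53 : liuPass_lemma53) (hGeff : condGen_polyTime)
    (hReff : condRedRun_polyTime) : condEPPRG_of_OWFExist := by
  intro hOWF γ δ hγ hδ
  obtain ⟨f, hf⟩ := hOWF
  have hS : IsSOWF f (lpRegSet f) := isSOWF_lpRegSet hf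
  have hreg : IsRegularOver f (lpRegSet f) (lpRegIdx f) := fun n x hx => preimCard_of_mem_lpRegSet hx
  have hdense : ∀ n, 1 ≤ n → 2 ^ n ≤ n * (lpRegSet f n).card := fun n hn => card_lpRegSet f hn
  obtain ⟨c, hc, hfam⟩ := h53 f (lpRegSet f) (lpRegIdx f) hS hreg hdense
  obtain ⟨F, Hc, hFpoly, hHpoly, hlen, hdens, hpr⟩ := hfam (2 * (2 * c + c * δ + 1)) (2 * (2 * (2 * c + c * δ + 1)) + 8 * (c + 1) * (γ + 1))
  let Q : CondParams := ⟨c, γ, δ, lpRegIdx f, F, Hc⟩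
  have H : Q.Hyps (lpRegSet f) := ⟨hc, lpRegIdx_le f, hdense, hlen, hdens⟩
  refine ⟨Q.G, Q.E (lpRegSet f), Q.γ' + 2, hGeff Q hc hFpoly hHpoly, fun N => Q.E_spec (lpRegSet f) N, Q.length_G hc, ?_, ?_⟩
  · intro D hD
    exact CondParams.pseudorandom_G H hδ.le hpr (fun D' qD cl hD' _ hcl => Q.isPPT_red_of hReff D' qD cl hD' hcl) D hD
  · exact CondParams.entropy_G H

end Assembly

end Literature.Computability.Cryptography
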